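import Summits.BirchSwinnertonDyer.BirchSwinnertonDyer.Theorems.ErratumRoadFiveEulerHalfNotRamE0PrimeReceptacle
import Summits.BirchSwinnertonDyer.Rank1Residual.X11b.BDPRouteTamagawaSupport
import Literature.NumberTheory.EllipticCurves.RingClassGalOverCyclicProofs
import Literature.NumberTheory.EllipticCurves.RingClassFieldDecompositionLaw
import Summits.BirchSwinnertonDyer.BirchSwinnertonDyer.Theorems.ErratumRoadFiveAuxNormRelativeStabilizerLaw
import Summits.BirchSwinnertonDyer.BirchSwinnertonDyer.Theorems.ErratumRoadFiveAuxPrimeSupply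
import Summits.BirchSwinnertonDyer.BirchSwinnertonDyer.Theorems.ClassRecordThreeEulerHalvesAtThreeCarrierLocalE0Global
import Summits.BirchSwinnertonDyer.BirchSwinnertonDyer.Theorems.ClassRecordThreeCornerAtThreeShimuraWalkSplitCarrier
import Summits.BirchSwinnertonDyer.BirchSwinnertonDyer.Theorems.ClassRecordThreeEulerHalvesAtThreeShimuraAuxNormE0Prime
import HarnessLib

/-!
# Line `aux_norm_receptacle` v6 (bsd-idea-9 g10; v2 = two stubs S1/S3; v3 = S3 split into S2♭ + S3♭, glue proved; v4 = S3♭ split into (C) + (O), glue proved; v5 = S2♭ CLOSED BY NAME (p642411), the K-linear form S1-lin typed and §2 proved from it; v6 = (i) the LEAF is now S1-lin = `stub_tateComponentFamilyLinear`, the text REGISTERED by LEAD er5-p1 g3's `Lines/birth.lean` v15 «birth ⊕ aux_norm graft», (ii) S3♭ CLOSED BY NAME by the tree theorem `Theorems.AuxPrimeSupply.auxiliaryPrimeSupply` (bsd-line-er5-p1-w2 g5, p645521) so (C) ∕ (O) are no longer leaves of this file (ONE `sorry` left: S1-lin), (iii) NEW §5 ROAD B: the binder hE0T from TREE THEOREMS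 ONLY — (T)+(C) at an odd prime `p ∣ c_q` over unramified places (port of bsd-stepL-tam3-p1 g18's `CarrierLocalE0` files from `3 ∣ c_q` to odd `p ∣ c_q`) composed with `ShimuraWalk.carrierLabelsE0Prime_of_galTrivial_of_kills_of_auxLevel` (p641143) and AUX (S2♭ p642411 + S3♭ p645521 + this file's glue = p644422 verbatim): ZERO leaf stubs) for crux `EulerHalfNotRamNoInertSetAtFive` (stmt-BirchSwinnertonDyer-19715),
# route `ErratumRoadFive` (K2, `p ≥ 5`): the BEYOND-PRINT conjunct of LAB — the identity-component label at the K-SPLIT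
# multiplicative carriers `q ∉ S`, `p ∣ c_q(E)` — from TWO PRINTABLE STUBS by an auxiliary inert norm, in the tree's E′-currency.

THE LEVER (card `Ideas/aux-norm-receptacle.md`). The walk never needs (B6) «`y_m − t ∈ E⁰(K[m]_w)`»; it needs the E′-label
«`n' • y_m ∈ E₀(K[m])_w` for ONE `n'` prime to `p`» (width seat -w3 g5, `Theorems/ErratumRoadFiveEulerHalfNotRamE0PrimeReceptacle.lean`,
binder `hE0T`). At a split multiplicative carrier `q = 𝔮 𝔮̄` (every carrier outside `S` is K-split on the `p ≥ 5` frame: `hsp`) the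
component group at each place `w ∣ q` of `K[m]` is `ℤ/c`, `c = ord_q Δ_min(E) = c_q` (unramified), and Gross's norm relation (B4) of
`ShimuraWalk.LabelsAt` at an AUXILIARY inert level `ℓ₀ m` read through the component character gives, at a place `w̃ ∣ w`,
`∑_{i ≤ ℓ₀} comp_{σ^{-i} w̃}(y_{ℓ₀ m}) = a_{ℓ₀} · comp_w(y_m)` in `ℤ/c`; the left side is a multiple of `#Stab_{⟨σ⟩}(w̃) = f(w̃ ∣ w)`
(orbit counting), so if `p^e ∣ f(w̃ ∣ w)` (`e = ord_p c`) and `p ∤ a_{ℓ₀}` then `(c / p^e) • y_m ∈ ker comp_w = E₀`. Chebotarev in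
`K(E[p^{e'}], (β̄/β)^{1/p})` supplies such `ℓ₀` for every level `m` (`σ|_K ≠ 1`, `det ρ(σ) = −1`, `tr ρ̄(σ) = 3/2`, Kummer coordinate free
because `SL₂(ℤ/p^{e'})` is perfect for `p ≥ 5` and `β̄/β ∉ K^{×p}`); the witness `n' = c / p^e` is UNIFORM in `m`.

CONTENTS.
* §0 abstract algebra (Mathlib only, kernel-checked): (A1) right-`D`-invariant sums on a finite group are `#D`-multiples; (A1′) orbit
  counting along a cyclic group `∑_{i<n} F(σ^{-i} x) ∈ #Stab_{⟨σ⟩}(x) • A`; (A2) in `ZMod c`: `a x = p^e t`, `a` prime to `p`, `p^e ∣ c`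
  ⟹ `(c/p^e) x = 0`; (A3) the three combined.
* §1 the FOUR LEAF STATEMENTS S1-lin, S2♭, (C), (O) as `def … : Prop` (since v6 ONE `sorry`: S1-lin `stub_tateComponentFamilyLinear` — S2♭ is closed by the tree theorem `Theorems.AuxNormReceptacle.relativeStabilizerLaw` (p642411) and S3♭ ⊇ (C) ∧ (O) by `Theorems.AuxPrimeSupply.auxiliaryPrimeSupply` (p645521), both BY NAME: `stub_relativeStabilizerLaw`, `auxiliaryPrimeSupply_of_tree`), typed over tree declarations, and two PROVED glues:
  `stub_tateComponentFamily` (S1, Tate-curve component characters on the CM tower at a split multiplicative `q`: kernel `= E₀`,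
  compatible with the inclusions `K[n₀] → K[n]`, Galois-covariant under `Aut_ℚ(K[n])` — registered text; v5 adds the K-linear form `TateComponentFamilyLinear` (covariance under
  `𝒢_n = ringClassGal ι n` only), `tateComponentFamilyLinear_of` : S1 → S1-lin, and proves §2 from S1-lin), `stub_relativeStabilizerLaw` (S2♭, PROVED in tree since v5; ring class CFT ONLY:
  `σ^{ℓ₀+1} = 1` and `#Stab_{⟨σ⟩}(w̃) · orderOf [𝔭_v]_{m₀} = orderOf [𝔭_v]_{ℓ₀m₀}` — the stabiliser is the relative decomposition
  group, its order the relative residue degree, expressed through the LANDED decomposition law `RingClassFieldDecompositionLaw`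
  of bsd-line-er5-p1-w4 g7), `stub_chebotarevKummerSupply` ((C), `q`-FREE: the generic Chebotarev–Kummer supply — for `γ ∈ 𝓞 K`,
  `N(γ) ∈ ℚ^{×p}`, `γ ∉ K^{×p}`: a prime `ℓ₀ ∉ T` inert with `p ∤ a_{ℓ₀}`, `p^E ∣ ℓ₀ + 1`, `γ` not a `p`-th power mod `ℓ₀𝓞_K`; the ONLY
  place Chebotarev/Serre enter), `stub_splitPrimeKummerWitness` ((O), `W`-FREE and `ι`-FREE: the Kummer witness `γ` of a split prime `q`
  and the order law `p^E ∣ orderOf [𝔭_v]_{ℓ₀}` at PRIME conductor — class field theory of orders in `K` + Hilbert 90); the PROVED glues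
  `auxiliaryPrimeSupply_of_CO` : (C) → (O) → S3♭ (`AuxiliaryPrimeSupply`: `ℓ₀ ∉ T` inert, `p ∤ a_{ℓ₀}`, `p^E ∣ orderOf [𝔭_v]_{ℓ₀}` for
  `v ∣ q`) and `auxiliaryInertLevel_of_laws` : S2♭ → S3♭ → S3 (`AuxiliaryInertLevel`: `ℓ₀ = ℓ₀(m₀, e)` with `σ^{ℓ₀+1} = 1` and
  `p^e ∣ #Stab_{⟨σ⟩}(w̃)` at every `w̃ ∋ q`), via `orderOf_primeClass_dvd_of_dvd`, `orderOf_dvd_natCard`, `finite_ringClassGroup` and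
  `p`-adic bookkeeping. Dependency graph: hE0T ⇐ S1 ∧ S3 per carrier; S3 ⇐ S2♭ ∧ S3♭; S3♭ ⇐ (C) ∧ (O).
* §2 the SORRY-FREE composition `labelE0Prime_at_splitCarrier_of_linear` (v5; from S1-lin) and `labelE0Prime_at_splitCarrier_of_stubs` (v2–v4 signature): S1-statement → S3-statement → (B4) of `LabelsAt` →
  `p ∣ c_q(E/ℚ_q)` → the E′-label at `q` VERBATIM in the shape of the binder `hE0T` of
  `ShimuraKolyvaginOfImage.exists_uniform_exponent_of_carrierLabelsE0Prime` ∕ the producers of §4 of that file; and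
  `carrierLabelsE0Prime_of_stubs`, the `hE0T` binder itself on a frame with `hsp`.
* §3 the plug into the tree (an `example`: the uniform exponent over all carriers from the stubs' statements).
* §4 (v6) ROAD A with ONE leaf: `carrierLabelsE0Prime_of_linear_leaf` — hE0T from S1-lin alone (S2♭, S3♭ by name), on frames with `d_K < −4` and (surj).
* §5 (v6) ROAD B with ZERO leaves: `CarrierLocalE0OddPrime.*` — `c_w = c_q`, (C_w), (T_w), (C), (T) at an odd prime `p ∣ c_q` over a place
  unramified over `ℚ` (port of bsd-stepL-tam3-p1 g18's `Theorems.CarrierLocalE0.*`, p643818 ∕ p644399, hypothesis `3 ∣ c_q` ↦ odd `p ∣ c_q`; at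
  `p ≥ 5` every carrier is split `I_{c_q}` and the type-IV branch is void), `carrierLocalE0_ringClassField_of_odd_prime_dvd` (on `K[n]`, `q` K-split,
  `q ∤ n`: `Theorems.CarrierLocalE0.not_map_le_sq_ringClassField`, p645044), and the assembled `carrierLabelsE0Prime_of_galTrivialRoad` ∕
  `exists_uniform_exponent_of_galTrivialRoad`: the binder hE0T ∕ the uniform exponent from `ShimuraWalk.carrierLabelsE0Prime_of_galTrivial_of_kills_of_auxLevel`
  (p641143) + AUX, with NO S1 ∕ S1-lin ∕ (C) ∕ (O) hypothesis. Road B needs no component character: (B4) is read through «`Aut_ℚ(K[ℓ₀m])_w̃` acts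
  trivially on `E ∕ E₀,w̃`» ((T): `E(K[n]_w) = E(ℚ_q) + E₀` since `c_w = c_q`) and «`c_q` kills `E ∕ E₀`» ((C)).

HONEST FRAMING. Nothing here closes 19715; `sorry` occurs exactly ONCE, in `stub_tateComponentFamilyLinear` (v6; `stub_relativeStabilizerLaw` and
`auxiliaryPrimeSupply_of_tree` are one-term proofs by tree theorems; the v5 `sorry`d (C) ∕ (O) theorems are gone — their `def`s and the glue
`auxiliaryPrimeSupply_of_CO` stay as the alternative road to S3♭); §0, §2, §3, §5 are kernel-checked modulo nothing (the leaves enter §2–§4 as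
HYPOTHESES; §5 has none). The line REPLACES the beyond-print (B6)@carriers conjunct of item (ii) of RULING 65 by
S1 (Silverman ATAEC IV.9, V.4–5: in print), S2♭ (ring class CFT: in print AND largely in tree), (C) (Chebotarev + Serre + Kummer: in print) and (O) (CFT of orders in K + Hilbert 90: in print AND largely in tree) at the K-split carriers; it does not
touch the inert set `S`, the primitives, or the closer. BSD is proved for no curve by this file; no summit statement is proved here.
The skeleton of record of 19715 stays the LEAD's `Lines/birth.lean` (v14 f54f07a69c312310 at the time of writing; LEAD er5-p1 g3 announced
14:50:06Z a v15 «birth ⊕ aux_norm graft» registering S1 ∕ S2♭ ∕ (C) ∕ (O) as leaf stubs over a `Theorems/ErratumRoadFiveAuxNormReceptacleDefs`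
module) (W-79): this file is published by `ledger crux write` only and registers nothing.

TREE PROGRESS ON THE LEAVES (2026-08-28T14:55Z; p-ids from cell STATUS): S2♭ PROVED VERBATIM — `Theorems/ErratumRoadFiveAuxNormRelativeStabilizerLaw.lean`
(bsd-line-er5-p1-w4 g8, p642411, on `Literature/…/RingClassFieldDecompositionGroup` p640958, `…DecompositionGroupGenerator` p641679 + §4 p642026,
`…DecompositionLaw` p638696); toward (C)∕(O) (bsd-line-er5-p1-w2 g5): F1 p640886 `Literature/NumberTheory/QuadraticFields/RingClassPrimeConductorOrder.lean`
`RingClass.pow_dvd_orderOf_primeClass_of_inert` (the order law at prime conductor from the Kummer non-residue condition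
`β^((ℓ²−1)/p) − 1 ∉ ℓ𝓞_K`, `v^h = (β)`), F2 p641931 `Theorems/ErratumRoadFiveAuxPrimeOfFrobeniusWitness.lean`
`AuxPrimeSupply.exists_auxPrime_of_frobeniusWitness` (Chebotarev from ONE Frobenius witness `γ ∈ Γ_ℚ`: `γ ∉ Γ_K`, `γ ζ = ζ⁻¹`, `tr ρ̄(γ) ≠ 0`,
`γ² α ≠ α`), F3a (the witness from `ρ̄` surjective, `p ≥ 5`) + KEX (Kummer exclusion) in flight; (O) claimed by -w4 g8 (14:49:57Z, `γ := β̄^{p+1} β^{p−1}`);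
S1 claimed by -w3 g6 (F1a `Literature/…/TateNormalFormComponentHomProofs.lean` announced 14:51:36Z: the component homomorphism of a Tate normal
form over `K̄_v`, kernel `E₀`, invariant under `Γ_{K_v}`). Two assembly roads to S3♭ `AuxiliaryPrimeSupply` coexist and do not compete: (i) this
file's `auxiliaryPrimeSupply_of_CO` from (C) ∧ (O) as typed; (ii) the cell's F1 + F2 + F3a + KEX directly in F-currency (at `v = 𝔮̄` via
`orderOf_primeClass_eq_of_under_eq`, p640958) — whichever lands first closes the S3♭ hypothesis of `auxiliaryInertLevel_of_laws`.

References (locators only): [cite: GrossLMS1991, §3 Prop. 3.7 (1) (p. 239), §6 proof of Prop. 6.2 (1) (p. 245 «E′»)]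
[cite: SilvermanATAEC1994, IV Cor. 9.2 (d), V Lemma 4.? (Tate curve over unramified extensions), C.15] [cite: SilvermanAEC2009, VII Prop. 2.1]
[cite: Cox2013, Thm. 7.24, §9.A, Thm. 11.1] [cite: Serre1972, §4 Lemme 3 (p ≥ 5: GL₂(ℤ_p) from GL₂(𝔽_p))] [cite: Jetchev2008, Prop. 4.9].
presearch: «component group norm relation auxiliary prime Heegner point E⁰» → none as a lemma (queries "Tate curve component group
norm compatible unramified", "Heegner point identity component auxiliary prime", corpus fts+vec and galaxy "component group|Heegner";
nearest [corpus:GrossLMS1991 p.245] «replace E⁰ by E′», which is the currency, not the mechanism).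
-/

set_option autoImplicit false
set_option linter.dupNamespace false
set_option linter.unusedVariables false

noncomputable section

open scoped Classical NumberField Pointwise

namespace Summit.BirchSwinnertonDyer.BirchSwinnertonDyer.Cruxes.EulerHalfNotRamNoInertSetAtFive.AuxNormReceptacle

open WeierstrassCurve IsDedekindDomain NumberField Field Literature.NumberTheory.EllipticCurves
  Literature.NumberTheory.GaloisRepresentations Summit.BirchSwinnertonDyer.Rank1Residual.X11b
  Summit.BirchSwinnertonDyer.BirchSwinnertonDyer.Theorems Rat.HeightOneSpectrum
  Literature.NumberTheory.NumberFields Literature.NumberTheory.NumberFields.RingClassField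
  Literature.NumberTheory.QuadraticFields.RingClass

/-! ## §0 Abstract algebra (Mathlib only) -/

/-- (A1) A function on a finite group which is invariant under right translation by a subgroup `D`
has total sum divisible by `#D`. [folklore] -/
theorem exists_sum_eq_card_nsmul {H : Type*} [Group H] [Fintype H] (D : Subgroup H)
    {A : Type*} [AddCommMonoid A] (c : H → A) (hc : ∀ h : H, ∀ d ∈ D, c (h * d) = c h) :
    ∃ t : A, ∑ h, c h = Nat.card D • t := by
  classical
  have hfac : ∀ h : H, c h = c (Quotient.out (QuotientGroup.mk (s := D) h)) := by
    intro h
    set q : H ⧸ D := QuotientGroup.mk h with hq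
    have hmem : (Quotient.out q)⁻¹ * h ∈ D := by
      rw [← QuotientGroup.eq, QuotientGroup.out_eq']
    have : h = Quotient.out q * ((Quotient.out q)⁻¹ * h) := by group
    calc c h = c (Quotient.out q * ((Quotient.out q)⁻¹ * h)) := by rw [← this]
      _ = c (Quotient.out q) := hc _ _ hmem
  have hfib : ∀ q : H ⧸ D,
      (Finset.univ.filter (fun h : H => (QuotientGroup.mk (s := D) h) = q)).card = Nat.card D := by
    intro q
    rw [← Fintype.card_subtype, ← Nat.card_eq_fintype_card]
    let f : D → {h : H // (QuotientGroup.mk (s := D) h) = q} := fun d =>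
      ⟨Quotient.out q * d, by
        rw [← QuotientGroup.out_eq' q]
        refine (QuotientGroup.eq.mpr ?_).symm
        · simp⟩
    have hf : Function.Bijective f := by
      constructor
      · intro d d' hdd'
        have := congrArg Subtype.val hdd'
        simp only [f] at this
        exact Subtype.ext (mul_left_cancel this)
      · rintro ⟨h, hh⟩
        have hmem : (Quotient.out q)⁻¹ * h ∈ D := by
          rw [← QuotientGroup.eq, QuotientGroup.out_eq', hh]
        exact ⟨⟨_, hmem⟩, Subtype.ext (by simp [f])⟩
    exact (Nat.card_eq_of_bijective f hf).symm
  refine ⟨∑ q : H ⧸ D, c (Quotient.out q), ?_⟩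
  calc ∑ h, c h = ∑ h, c (Quotient.out (QuotientGroup.mk (s := D) h)) :=
        Finset.sum_congr rfl fun h _ => hfac h
    _ = ∑ q : H ⧸ D, ∑ h ∈ Finset.univ.filter (fun h : H => (QuotientGroup.mk (s := D) h) = q),
          c (Quotient.out q) :=
        (Finset.sum_fiberwise' Finset.univ (fun h : H => (QuotientGroup.mk (s := D) h))
          (fun q => c (Quotient.out q))).symm
    _ = ∑ q : H ⧸ D, Nat.card D • c (Quotient.out q) := by
        refine Finset.sum_congr rfl fun q _ => ?_
        rw [Finset.sum_const, hfib q]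
    _ = Nat.card D • ∑ q : H ⧸ D, c (Quotient.out q) := by rw [Finset.smul_sum]

/-- (A1′) **Orbit counting along a cyclic group.** For `σ` with `σ ^ n = 1` acting on `X` and any `F : X → A`:
`∑_{i<n} F (σ^{-i} • x)` is a multiple of the order of the stabiliser of `x` in `⟨σ⟩` (in the application: of the
decomposition group, i.e. of the residue degree `f(w̃ ∣ w)`). [folklore] -/
theorem exists_sum_range_eq_card_stabilizer_nsmul {G : Type*} [Group G] {X : Type*} [MulAction G X]
    {A : Type*} [AddCommMonoid A] (σ : G) {n : ℕ} (hn : σ ^ n = 1) (x : X) (F : X → A) :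
    ∃ t : A, ∑ i ∈ Finset.range n, F ((σ ^ i)⁻¹ • x) =
      Nat.card (MulAction.stabilizer (Subgroup.zpowers σ) x) • t := by
  classical
  rcases Nat.eq_zero_or_pos n with rfl | hnpos
  · exact ⟨0, by simp⟩
  have hfin : IsOfFinOrder σ := isOfFinOrder_iff_pow_eq_one.mpr ⟨n, hnpos, hn⟩
  have hd : 0 < orderOf σ := hfin.orderOf_pos
  have hdn : orderOf σ ∣ n := orderOf_dvd_of_pow_eq_one hn
  -- the summand is `orderOf σ`-periodic
  set f : ℕ → A := fun i => F ((σ ^ i)⁻¹ • x) with hfdef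
  have hmul : ∀ k : ℕ, ∑ i ∈ Finset.range (orderOf σ * k), f i = k • ∑ i ∈ Finset.range (orderOf σ), f i := by
    intro k
    induction k with
    | zero => simp
    | succ k ih =>
      rw [Nat.mul_succ, Finset.sum_range_add, ih, succ_nsmul]
      congr 1
      refine Finset.sum_congr rfl fun i _ => ?_
      simp only [hfdef, pow_add, pow_mul, pow_orderOf_eq_one, one_pow, one_mul]
  -- the sum over one period is the sum over the subgroup `⟨σ⟩`
  haveI : Finite (Subgroup.zpowers σ) := Nat.finite_of_card_ne_zero (by rw [Nat.card_zpowers]; exact hd.ne')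
  letI : Fintype (Subgroup.zpowers σ) := Fintype.ofFinite _
  have h1 : ∑ i ∈ Finset.range (orderOf σ), f i = ∑ h : Subgroup.zpowers σ, F ((h : G)⁻¹ • x) := by
    rw [Finset.sum_range]
    exact Fintype.sum_equiv (finEquivZPowers hfin) _ _ fun i => by
      simp [hfdef, finEquivZPowers_apply]
  have h2 : ∑ h : Subgroup.zpowers σ, F ((h : G)⁻¹ • x) = ∑ h : Subgroup.zpowers σ, F ((h : G) • x) :=
    Fintype.sum_equiv (Equiv.inv (Subgroup.zpowers σ)) _ _ fun h => by simp
  obtain ⟨t, ht⟩ := exists_sum_eq_card_nsmul (MulAction.stabilizer (Subgroup.zpowers σ) x)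
    (fun h : Subgroup.zpowers σ => F ((h : G) • x)) fun h d hd => by
      rw [MulAction.mem_stabilizer_iff, Subgroup.smul_def] at hd
      show F (((h * d : Subgroup.zpowers σ) : G) • x) = F ((h : G) • x)
      rw [Subgroup.coe_mul, mul_smul, hd]
  obtain ⟨k, hk⟩ := hdn
  refine ⟨k • t, ?_⟩
  rw [hk, hmul k, h1, h2, ht, smul_comm]

/-- (A2) In `ZMod n`: if `a * x = f * t` with the INTEGER `a` prime to `p`, `p ^ e ∣ n` and `p ^ e ∣ f`, then
`(n / p ^ e) * x = 0` (Bezout `α a + β p^e = 1`). [folklore] -/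
theorem div_pow_mul_eq_zero_of_int {n : ℕ} {p e f : ℕ} {a : ℤ} (hap : IsCoprime a (p : ℤ))
    (hn : p ^ e ∣ n) (hf : p ^ e ∣ f) {x t : ZMod n} (h : (a : ZMod n) * x = (f : ZMod n) * t) :
    ((n / p ^ e : ℕ) : ZMod n) * x = 0 := by
  obtain ⟨α, β, hαβ⟩ := hap.pow_right (n := e)
  have h1 : (a : ZMod n) * (((n / p ^ e : ℕ) : ZMod n) * x) = 0 := by
    have hdvd : n ∣ n / p ^ e * f := by
      obtain ⟨k, hk⟩ := hf
      rw [hk, ← mul_assoc, Nat.div_mul_cancel hn]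
      exact dvd_mul_right n k
    calc (a : ZMod n) * (((n / p ^ e : ℕ) : ZMod n) * x)
        = ((n / p ^ e : ℕ) : ZMod n) * ((a : ZMod n) * x) := by ring
      _ = ((n / p ^ e : ℕ) : ZMod n) * ((f : ZMod n) * t) := by rw [h]
      _ = ((n / p ^ e * f : ℕ) : ZMod n) * t := by push_cast; ring
      _ = 0 := by rw [(ZMod.natCast_eq_zero_iff _ _).mpr hdvd, zero_mul]
  have h2 : ((p : ZMod n) ^ e) * (((n / p ^ e : ℕ) : ZMod n) * x) = 0 := by
    calc ((p : ZMod n) ^ e) * (((n / p ^ e : ℕ) : ZMod n) * x)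
        = ((p ^ e * (n / p ^ e) : ℕ) : ZMod n) * x := by push_cast; ring
      _ = 0 := by rw [Nat.mul_div_cancel' hn, ZMod.natCast_self, zero_mul]
  calc ((n / p ^ e : ℕ) : ZMod n) * x
      = ((α * a + β * (p : ℤ) ^ e : ℤ) : ZMod n) * (((n / p ^ e : ℕ) : ZMod n) * x) := by
        rw [hαβ]; push_cast; ring
    _ = (α : ZMod n) * ((a : ZMod n) * (((n / p ^ e : ℕ) : ZMod n) * x)) +
          (β : ZMod n) * (((p : ZMod n) ^ e) * (((n / p ^ e : ℕ) : ZMod n) * x)) := by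
        push_cast; ring
    _ = 0 := by rw [h1, h2, mul_zero, mul_zero, add_zero]

/-- (A3) **The auxiliary-norm divisibility kills the prime-to-`p` part of the component.** From a norm relation read
in `ZMod c` — `∑_{i<n} F(σ^{-i} • x) = a • z` — with `σ ^ n = 1`, `p ^ e ∣ #Stab_{⟨σ⟩}(x)`, `p ^ e ∣ c` and `a` prime to `p`:
`(c / p^e) • z = 0`. [folklore] -/
theorem div_pow_smul_eq_zero_of_sum_range {G : Type*} [Group G] {X : Type*} [MulAction G X] {c : ℕ}
    (σ : G) {n : ℕ} (hn : σ ^ n = 1) (x : X) (F : X → ZMod c) {z : ZMod c} {a : ℤ} {p e : ℕ}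
    (hap : IsCoprime a (p : ℤ)) (hc : p ^ e ∣ c)
    (hstab : p ^ e ∣ Nat.card (MulAction.stabilizer (Subgroup.zpowers σ) x))
    (hsum : ∑ i ∈ Finset.range n, F ((σ ^ i)⁻¹ • x) = a • z) :
    (c / p ^ e) • z = 0 := by
  obtain ⟨t, ht⟩ := exists_sum_range_eq_card_stabilizer_nsmul σ hn x F
  rw [hsum, nsmul_eq_mul, zsmul_eq_mul] at ht
  rw [nsmul_eq_mul]
  exact div_pow_mul_eq_zero_of_int hap hc hstab ht

/-- Toy check of (A2) with `c = 50`, `p = 5`, `e = 2`, `a = a_{ℓ₀} = -3`, `p^e = 25`: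
`-3 x = 25 t (mod 50) ⇒ 2 x = 0 (mod 50)`. -/
example : ∀ x t : ZMod 50, (-3 : ZMod 50) * x = 25 * t → (2 : ZMod 50) * x = 0 := by decide

/-! ## §1 The stubs S1, S2♭, (C), (O) (statements as `def … : Prop`, each a `sorry`d theorem under its print hypotheses) and the derived S3♭, S3 -/

section Stubs

variable (W : WeierstrassCurve ℚ) [W.IsElliptic] [W.IsGloballyMinimal] (K : Type) [Field K] [NumberField K]
  (ι : K →+* ℂ)

/-- **S1 — the Tate component characters on the CM tower at a split multiplicative prime `q`.** A family
`comp n w : E(K[n]) →+ ℤ/c`, `c = ord_q Δ_min(E)`, over the levels `n ≥ 1` prime to `q` and the places `w ∋ q` of `K[n]`, with: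
(K1) `comp n w P = 0 ↔ P ∈ E₀(K[n])_w` (nonsingular reduction on the globally minimal `W`; `q` is unramified in `K[n]`, so `W` stays
minimal at `w` and `Φ_w ≅ ℤ/c`, Kodaira–Néron for split `I_c`); (K2) compatibility with the inclusion `K[n₀] → K[n]` (`n₀ ∣ n`; every
`w₀ ∋ q` of `K[n₀]` lies under some `w ∋ q` of `K[n]`, `e(w ∣ w₀) = 1`); (K3) Galois covariance `comp_{τ w'}(τ P) = comp_{w'}(P)` for every
`τ ∈ Aut_ℚ(K[n])` (`τ • 𝔓 = τ(𝔓)`, Mathlib's pointwise action of `Aut_ℚ(K[n])` on the ideals of `𝓞 K[n]`) — the REGISTERED text (= v4 =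
LEAD er5-p1 g3's Defs file); §2 consumes only its K-linear part `τ ∈ ringClassGal ι n`, typed separately since v5 as `TateComponentFamilyLinear`
(see there for why both forms are true and which construction gives which).
Informal content: Silverman ATAEC V §4–5 (Tate curve `E_q(L_w) ≅ L_w^×/q_E^ℤ` functorial in unramified `L_w/ℚ_q`), IV Cor. 9.2 (d),
C.15; tree twins at ONE Henselian place: `TateNormalFormComponents.exists_addMonoidHom_zmod_of_tateNormalForm`,
`TateNormalFormUnramifiedComponentsProofs.exists_rational_generator_of_tateNormalForm`, `MultiplicativeComponentGroupOrder.*`.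
Why (K1)–(K3) are simultaneously satisfiable with VALUES matching (critic V46): ONE Tate uniformisation of `E/ℚ_q` (split multiplicative
OVER `ℚ_q` by `hs`; unique up to `[−1]`, `j ∉ ℤ_q ⇒ Aut = ±1`) base-changes to every completion `K[n]_w`, `w ∣ q` unramified, so
`comp n w := ord_w ∘ (Tate coordinate) mod c` is one coherent choice — this gives covariance under every `τ ∈ Aut_ℚ(K[n])`
(the clause of the v4 ∕ v14 registration); the K-linear part alone already feeds §2 (`TateComponentFamilyLinear`, v5) and is the v15-registered leaf. A statement; no longer asserted by this file (v6). [cite: SilvermanATAEC1994, IV Cor. 9.2 (d), V Thm. 3.1, V Lemma 5.? ; C.15]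
[cite: SilvermanAEC2009, VII Prop. 2.1] -/
def TateComponentFamily [∀ j : ℕ, NumberField (ringClassField K ι j)] (q : ℕ) : Prop :=
  ∃ comp : (n : ℕ) → HeightOneSpectrum (𝓞 (ringClassField K ι n)) →
      ((W.baseChange (ringClassField K ι n)).toAffine.Point →+ ZMod (padicValInt q W.minimalDiscriminantInt)),
    (∀ n : ℕ, n ≠ 0 → ¬ q ∣ n → ∀ (w : HeightOneSpectrum (𝓞 (ringClassField K ι n))),
        ((q : ℕ) : 𝓞 (ringClassField K ι n)) ∈ w.asIdeal →
        ∀ P : (W.baseChange (ringClassField K ι n)).toAffine.Point,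
          comp n w P = 0 ↔
            (placeIntModel W (ringClassField K ι n) w).HasNonsingularReduction (K := ringClassField K ι n) P) ∧
    (∀ n n₀ : ℕ, n ≠ 0 → ¬ q ∣ n → n₀ ∣ n →
        ∀ f : ringClassField K ι n₀ →ₐ[ℚ] ringClassField K ι n,
          (∀ x : ringClassField K ι n₀, ((f x : ringClassField K ι n) : ℂ) = (x : ℂ)) →
        ∀ w₀ : HeightOneSpectrum (𝓞 (ringClassField K ι n₀)),
          ((q : ℕ) : 𝓞 (ringClassField K ι n₀)) ∈ w₀.asIdeal →
        ∃ w : HeightOneSpectrum (𝓞 (ringClassField K ι n)), ((q : ℕ) : 𝓞 (ringClassField K ι n)) ∈ w.asIdeal ∧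
          ∀ P : (W.baseChange (ringClassField K ι n₀)).toAffine.Point,
            comp n w (WeierstrassCurve.Affine.Point.map (W' := W) f P) = comp n₀ w₀ P) ∧
    (∀ n : ℕ, n ≠ 0 → ¬ q ∣ n → ∀ (τ : ringClassField K ι n ≃ₐ[ℚ] ringClassField K ι n)
        (w w' : HeightOneSpectrum (𝓞 (ringClassField K ι n))),
        w.asIdeal = τ • w'.asIdeal →
        ∀ P : (W.baseChange (ringClassField K ι n)).toAffine.Point,
          comp n w (pointGalHom W (ringClassField K ι n) τ P) = comp n w' P)

/-- **S1-lin — the K-LINEAR form of S1 (v5).** `TateComponentFamily` with clause (K3) asked only for `τ ∈ 𝒢_n = Gal(K[n]/K)`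
= `ringClassGal ι n` (the subgroup of `Aut_ℚ(K[n])` fixing `ι(K)`): this is ALL the composition of §2 consumes ((K3) is applied at
`τ = σ^i ∈ G_{ℓ₀} = ringClassGalOver ι (ℓ₀m₀) m₀ ≤ ringClassGal ι (ℓ₀m₀)`), and it is what a LOCAL construction based at the places
`v` of `K` (width seat -w3 g6: `exists_componentHom_of_tateNormalForm`, p642730, (4) = invariance under `Γ_{K_v}`, pulled back along
K-embeddings `K[n] → K̄_v`) yields without comparing the data at `v` and `v̄`. The REGISTERED stub text (LEAD er5-p1 g3's
`Theorems/ErratumRoadFiveAuxNormReceptacleDefs.lean`, = v4) is the full clause over `Aut_ℚ(K[n])`, which is also true under `hs` (base the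
construction at the rational place `q`: `W/ℚ` is split multiplicative over `ℚ_q`, ONE `ℚ_q`-rational change of variables to the Tate normal
form serves every `w ∣ q`, and embeddings `K[n] → ℚ̄_q` inducing the same place are `Γ_{ℚ_q}`-conjugate) — `tateComponentFamilyLinear_of`
records full ⟹ linear; a prover who lands only the K-linear form closes `labelE0Prime_at_splitCarrier_of_linear` below and asks the LEAD
for a `--restate`. A statement, weaker than S1. [cite: SilvermanATAEC1994, IV Cor. 9.2 (d), V Thm. 3.1; C.15] [cite: GrossLMS1991, §4 (𝒢_n)] -/
def TateComponentFamilyLinear [∀ j : ℕ, NumberField (ringClassField K ι j)] (q : ℕ) : Prop :=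
  ∃ comp : (n : ℕ) → HeightOneSpectrum (𝓞 (ringClassField K ι n)) →
      ((W.baseChange (ringClassField K ι n)).toAffine.Point →+ ZMod (padicValInt q W.minimalDiscriminantInt)),
    (∀ n : ℕ, n ≠ 0 → ¬ q ∣ n → ∀ (w : HeightOneSpectrum (𝓞 (ringClassField K ι n))),
        ((q : ℕ) : 𝓞 (ringClassField K ι n)) ∈ w.asIdeal →
        ∀ P : (W.baseChange (ringClassField K ι n)).toAffine.Point,
          comp n w P = 0 ↔
            (placeIntModel W (ringClassField K ι n) w).HasNonsingularReduction (K := ringClassField K ι n) P) ∧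
    (∀ n n₀ : ℕ, n ≠ 0 → ¬ q ∣ n → n₀ ∣ n →
        ∀ f : ringClassField K ι n₀ →ₐ[ℚ] ringClassField K ι n,
          (∀ x : ringClassField K ι n₀, ((f x : ringClassField K ι n) : ℂ) = (x : ℂ)) →
        ∀ w₀ : HeightOneSpectrum (𝓞 (ringClassField K ι n₀)),
          ((q : ℕ) : 𝓞 (ringClassField K ι n₀)) ∈ w₀.asIdeal →
        ∃ w : HeightOneSpectrum (𝓞 (ringClassField K ι n)), ((q : ℕ) : 𝓞 (ringClassField K ι n)) ∈ w.asIdeal ∧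
          ∀ P : (W.baseChange (ringClassField K ι n₀)).toAffine.Point,
            comp n w (WeierstrassCurve.Affine.Point.map (W' := W) f P) = comp n₀ w₀ P) ∧
    (∀ n : ℕ, n ≠ 0 → ¬ q ∣ n → ∀ (τ : ringClassField K ι n ≃ₐ[ℚ] ringClassField K ι n)
        (w w' : HeightOneSpectrum (𝓞 (ringClassField K ι n))),
        τ ∈ ringClassGal ι n → w.asIdeal = τ • w'.asIdeal →
        ∀ P : (W.baseChange (ringClassField K ι n)).toAffine.Point,
          comp n w (pointGalHom W (ringClassField K ι n) τ P) = comp n w' P)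

omit [W.IsElliptic] in
/-- S1 ⟹ S1-lin (drop the hypothesis `τ ∈ ringClassGal ι n`). [folklore] -/
theorem tateComponentFamilyLinear_of [∀ j : ℕ, NumberField (ringClassField K ι j)] {q : ℕ}
    (h : TateComponentFamily W K ι q) : TateComponentFamilyLinear W K ι q := by
  obtain ⟨comp, h1, h2, h3⟩ := h
  exact ⟨comp, h1, h2, fun n hn hqn τ w w' _ hw P ↦ h3 n hn hqn τ w w' hw P⟩

/-- **S3 (⊇ S2) — the auxiliary inert level.** For every exponent `e` and every guarded level `m₀` there is a prime `ℓ₀ ∤ N m₀`, inert in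
`K`, with `p ∤ a_{ℓ₀}(E)`, such that for every generator `σ` of `G_{ℓ₀} = Gal(K[ℓ₀ m₀]/K[m₀])` (`ringClassGalOver ι (ℓ₀ m₀) m₀`):
`σ^{ℓ₀+1} = 1` (`#G_{ℓ₀} = ℓ₀ + 1`, `d_K < −4`) and `p^e` divides the order of the stabiliser in `⟨σ⟩` of every prime `w̃ ∋ q` of
`K[ℓ₀ m₀]` (= the decomposition group, of order the residue degree `f(w̃ ∣ w̃ ∩ K[m₀])` since `q ∤ ℓ₀` is unramified). Informal proof
(S2 = ring class CFT: `f(w̃ ∣ w) = ord(β̄/β mod ℓ₀)` in `𝔽_{ℓ₀²}^×/𝔽_{ℓ₀}^× ≅ μ_{ℓ₀+1}`, `(β) = 𝔮^{f(w ∣ 𝔮)}`; S3 = Chebotarev in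
`M = K(E[p^{e'}], (β̄₁/β₁)^{1/p})`, `e' = e + ord_p(f(w∣𝔮)/h_𝔮)`, class `σ|_K ≠ 1`, `ρ(σ) ~ diag(2, −2⁻¹)` (det `−1` ⟹ `ℓ₀ ≡ −1 (p^{e'})`,
trace `3/2 ≢ 0`), `σ²` non-trivial on the Kummer radical — admissible since `ρ_{E,p^∞}(G_ℚ) = GL₂(ℤ_p)` for `p ≥ 5` under (surj)
(Serre) and `SL₂(ℤ/p^{e'})` is perfect, so `(β̄₁/β₁)^{1/p} ∉ K(E[p^{e'}])` as `β̄₁/β₁ ∉ K^{×p}`). A statement; since v3 it is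
DERIVED: `auxiliaryInertLevel_of_laws : RelativeStabilizerLaw → AuxiliaryPrimeSupply → AuxiliaryInertLevel` (sorry-free). [cite: GrossLMS1991, §3 (p. 239: G_ℓ ≅ 𝔽_λ^×/𝔽_ℓ^× cyclic of order ℓ+1)] [cite: Cox2013, Thm. 7.24, §9.A]
[cite: Serre1972, §4.4 Lemme 3] -/
def AuxiliaryInertLevel [∀ j : ℕ, NumberField (ringClassField K ι j)] (p q N : ℕ) : Prop :=
  ∀ e m₀ : ℕ, Squarefree m₀ → (∀ r ∈ m₀.primeFactors, ¬ r ∣ N ∧ (Ideal.span {(r : 𝓞 K)}).IsPrime) →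
    ∃ ℓ₀ : ℕ, ℓ₀.Prime ∧ ¬ ℓ₀ ∣ N ∧ ¬ ℓ₀ ∣ m₀ ∧ (Ideal.span {(ℓ₀ : 𝓞 K)}).IsPrime ∧
      ¬ (p : ℤ) ∣ W.frobeniusTrace ℓ₀ ∧
      ∀ σ : ringClassField K ι (ℓ₀ * m₀) ≃ₐ[ℚ] ringClassField K ι (ℓ₀ * m₀),
        Subgroup.zpowers σ = ringClassGalOver ι (ℓ₀ * m₀) m₀ →
        σ ^ (ℓ₀ + 1) = 1 ∧
        ∀ w : HeightOneSpectrum (𝓞 (ringClassField K ι (ℓ₀ * m₀))),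
          ((q : ℕ) : 𝓞 (ringClassField K ι (ℓ₀ * m₀))) ∈ w.asIdeal →
          p ^ e ∣ Nat.card (MulAction.stabilizer (Subgroup.zpowers σ) w.asIdeal)

/-- **STUB S1-lin — the ONLY `sorry` of this file since v6** (Silverman ATAEC IV.9.2 (d), V §3–5, C.15; ≈ L): the K-LINEAR Tate component
characters exist at a split multiplicative prime `q` that splits in the imaginary quadratic `K` (so `q ∤ d_K`, and `q ∤ n` keeps `q` unramified in
`K[n]`). This is the text REGISTERED as `stub_tateComponentFamilyLinear` by LEAD er5-p1 g3's `Lines/birth.lean` v15 (over the tree twin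
`Theorems.AuxNormReceptacle.TateComponentFamilyLinear`, `Theorems/ErratumRoadFiveAuxNormReceptacleDefs.lean` p643374 + p644945, whose body is this
file's `TateComponentFamilyLinear` verbatim); bsd-line-er5-p1-w3 g6 is proving it (F1 `Literature/…/TateNormalFormComponentHom(Proofs)` p642730,
F2.1 `Theorems/ErratumRoadFiveEulerHalfNotRamTateComponentLocal.lean` p643753, F2.2 `…TateComponentGlobal.lean` p644863, F2.3 `…TateComponentSplitPlace.lean`
p645245, F2e `…TateComponentPlaces.lean`, F3 = this statement). The full form S1 = `TateComponentFamily` (covariance under all of `Aut_ℚ(K[n])`)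
is no longer asserted by this file (`tateComponentFamilyLinear_of` : S1 → S1-lin records the implication).
[cite: SilvermanATAEC1994, IV Cor. 9.2 (d), V Thm. 3.1, C.15] [cite: Cox2013, §9.A (ramification of ring class fields)] -/
theorem stub_tateComponentFamilyLinear [∀ j : ℕ, NumberField (ringClassField K ι j)] (hK : IsImaginaryQuadratic K)
    (q : ℕ) [Fact q.Prime] (hs : W.HasSplitMultiplicativeReductionAtPrime q)
    (hq2 : ((Ideal.span {(q : ℤ)}).primesOver (𝓞 K)).ncard = 2) :
    TateComponentFamilyLinear W K ι q := by
  sorry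

/-- **S2♭ — the relative stabiliser law in the ring class tower** (pure class field theory of orders; v3 split of S3). For
`m₀ ≥ 1`, a prime `ℓ₀ ∤ m₀` inert in `K`, `q ∤ ℓ₀ m₀`, and any generator `σ` of `G_{ℓ₀} = ringClassGalOver ι (ℓ₀ m₀) m₀`:
`σ^{ℓ₀+1} = 1` (`#G_{ℓ₀} ∣ ℓ₀ + 1`, Gross §3 / Cox Thm. 7.24), and for every prime `w̃ ∋ q` of `K[ℓ₀ m₀]` the prime `v` of `K`
below it satisfies `#Stab_{⟨σ⟩}(w̃) · orderOf [𝔭_v]_{m₀} = orderOf [𝔭_v]_{ℓ₀ m₀}` — i.e. the stabiliser (= decomposition group of `w̃`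
in `K[ℓ₀m₀]/K[m₀]`, Mathlib `Ideal.card_stabilizer_eq`: order `e·f = f(w̃ ∣ w̃ ∩ K[m₀])`, `e = 1` by
`ramificationIdx_ringClassField_eq_one`) has order the relative residue degree, which the landed relative decomposition law
`inertiaDeg_mul_orderOf_primeClass_eq_of_tower` (bsd-line-er5-p1-w4 g7, p638696) expresses through `orderOf (primeClass · v)`.
A statement; asserted only by `stub_relativeStabilizerLaw`. [cite: NeukirchANT1999, Ch. VI §7 Thm. (7.3); Ch. I §9 (9.4)]
[cite: Cox2013, §7.D Thm. 7.24, §9.A] [cite: GrossLMS1991, §3 (p. 239)] -/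
def RelativeStabilizerLaw [∀ j : ℕ, NumberField (ringClassField K ι j)] (q : ℕ) : Prop :=
  ∀ m₀ ℓ₀ : ℕ, m₀ ≠ 0 → ℓ₀.Prime → ¬ ℓ₀ ∣ m₀ → (Ideal.span {(ℓ₀ : 𝓞 K)}).IsPrime → ¬ q ∣ ℓ₀ * m₀ →
    ∀ σ : ringClassField K ι (ℓ₀ * m₀) ≃ₐ[ℚ] ringClassField K ι (ℓ₀ * m₀),
      Subgroup.zpowers σ = ringClassGalOver ι (ℓ₀ * m₀) m₀ →
      σ ^ (ℓ₀ + 1) = 1 ∧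
      ∀ w : HeightOneSpectrum (𝓞 (ringClassField K ι (ℓ₀ * m₀))),
        ((q : ℕ) : 𝓞 (ringClassField K ι (ℓ₀ * m₀))) ∈ w.asIdeal →
        ∃ v : HeightOneSpectrum (𝓞 K), ((q : ℕ) : 𝓞 K) ∈ v.asIdeal ∧
          Nat.card (MulAction.stabilizer (Subgroup.zpowers σ) w.asIdeal) * orderOf (primeClass m₀ v) =
            orderOf (primeClass (ℓ₀ * m₀) v)

/-- **S3♭ — the auxiliary prime supply at PRIME conductor** (Chebotarev–Kummer; v3 split of S3; `ι`-free). For every exponent `E`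
and every finite exclusion set `T`: a prime `ℓ₀ ∉ T`, `ℓ₀ ∤ N`, inert in `K`, with `p ∤ a_{ℓ₀}(E)` and `p^E ∣ orderOf [𝔭_v]_{ℓ₀}`
for BOTH primes `v ∣ q` of `K` (ring class group of prime conductor `ℓ₀`). Informal proof: `orderOf [𝔮]_{ℓ₀} = h_𝔮 · ord(x₁ mod ℓ₀)`
in `(𝒪_K/ℓ₀)^×/(ℤ/ℓ₀)^× ≅ μ_{ℓ₀+1}` (`(β₁) = 𝔮^{h_𝔮}` minimal, `x₁ = β̄₁/β₁ = q^{h_𝔮}/β₁²`; Cox (7.27) at prime conductor;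
`[𝔮̄]_{ℓ₀} = [𝔮]_{ℓ₀}^{-1}`), and Chebotarev in `M = K(E[p^E], x₁^{1/p})` (Galois over ℚ) with `σ = σ₀ a`, `σ₀|_K = conj`,
`ρ(σ₀) = diag(2, −2^{-1})` (det `−1` ⇒ `p^E ∣ ℓ₀ + 1`; trace `3/2`, `p ≥ 5`), `a ∈ A = Gal(M/K(E[p^E])) ≅ ℤ/p`: LOAD-BEARING
EXCLUSION (critic V43 (c)) `A ≠ 1` — `SL₂(ℤ/p^E)` perfect ⇒ `x₁^{1/p} ∈ K(E[p^E])` would force `x₁ ∈ K(μ_{p^E})^{×p}`, then (Kummer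
line over `K(μ_p)` trivial or `= K(μ_{p²})`) `x₁ ∈ K^{×p}`, and `β̄₁ = β₁δ^p` ⇒ (Hilbert 90, `β₁ = r ε^p`, `r ∈ ℚ^×`) `[𝔮]^{h_𝔮/p} = 1`,
contradicting minimality of `h_𝔮`; since `x̄₁ = x₁^{-1}` exactly, conj acts trivially on `A` and `σ² = σ₀² a²` sweeps the coset
`σ₀² A` (`p` odd), so all but at most one lift `σ` move `x₁^{1/p}`, i.e. `x₁` is not a `p`-th power mod `ℓ₀` (`Frob_{(ℓ₀)}(M/K) = σ²`,
`μ_p ⊂ 𝔽_{ℓ₀²}`), whence `v_p ord(x₁ mod ℓ₀) = v_p(ℓ₀² − 1) = v_p(ℓ₀ + 1) ≥ E`. Excluded finite set: `T ∪ {ℓ ∣ 2 p q N·N(β₁)·disc M}`.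
Needs (surj) and `p ≥ 5` (`ρ_{E,p^∞}(G_ℚ) = GL₂(ℤ_p)`, Serre), `q` split in `K` (for inert `q`, `[𝔮]_{ℓ₀} = 1` and the clause
fails for `E ≥ 1`). A statement; since v4 DERIVED: `auxiliaryPrimeSupply_of_CO : ChebotarevKummerSupply → SplitPrimeKummerWitness → AuxiliaryPrimeSupply`. [cite: Cox2013, §7.D (7.27), Thm. 8.12 (Chebotarev), §9.A]
[cite: Serre1972, §4.4 Lemme 3] [cite: GrossLMS1991, §3 (p. 239)] -/
def AuxiliaryPrimeSupply (p q N : ℕ) : Prop :=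
  ∀ (E : ℕ) (T : Finset ℕ), ∃ ℓ₀ : ℕ, ℓ₀.Prime ∧ ℓ₀ ∉ T ∧ ¬ ℓ₀ ∣ N ∧ (Ideal.span {(ℓ₀ : 𝓞 K)}).IsPrime ∧
    ¬ (p : ℤ) ∣ W.frobeniusTrace ℓ₀ ∧
    ∀ v : HeightOneSpectrum (𝓞 K), ((q : ℕ) : 𝓞 K) ∈ v.asIdeal → p ^ E ∣ orderOf (primeClass ℓ₀ v)

/-- **S2♭ — PROVED (v5)** by `Summit.BirchSwinnertonDyer.BirchSwinnertonDyer.Theorems.AuxNormReceptacle.relativeStabilizerLaw hK ι q`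
(bsd-line-er5-p1-w4 g8, p642411: conjunct 1 from `RingClassTower.isCyclic_and_card_dvd_succ_ringClassGalOver` — `#G_{ℓ₀} ∣ ℓ₀ + 1`, no
`d_K < −4` needed; conjunct 2 with `v := w ∩ 𝓞 K` from `card_stabilizer_mul_orderOf_primeClass_of_zpowers_eq`, p640958). Formerly STUB S2♭
(ring class CFT only; ≈ M): the relative stabiliser law on the CM tower of an imaginary quadratic `K`. Discharge route as foreseen in v3/v4: Mathlib `Ideal.card_stabilizer_eq` for the relative Galois group `ringClassGalOver ι (ℓ₀m₀) m₀` acting on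
`𝓞 K[ℓ₀ m₀]` over `𝓞 K[m₀]`, `ramificationIdx_ringClassField_eq_one`, `inertiaDeg_mul_orderOf_primeClass_eq_of_tower`,
`#ringClassGalOver ι (ℓ₀ m₀) m₀ ∣ ℓ₀ + 1` (`finrank_subfieldIn_ringClassField_eq_succ` / the `card_ringClassGalOver_eq_succ` pattern).
[cite: NeukirchANT1999, Ch. VI §7 Thm. (7.3)] [cite: Cox2013, §7.D Thm. 7.24, §9.A] -/
theorem stub_relativeStabilizerLaw [∀ j : ℕ, NumberField (ringClassField K ι j)] (hK : IsImaginaryQuadratic K)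
    (q : ℕ) [Fact q.Prime] : RelativeStabilizerLaw K ι q :=
  -- v5: NO LONGER A STUB — proved verbatim in the tree by bsd-line-er5-p1-w4 g8
  -- (`Theorems/ErratumRoadFiveAuxNormRelativeStabilizerLaw.lean`, p642411, commit b119e5798e84); the name is kept so that
  -- §1's glue `auxiliaryInertLevel_of_laws` and §2 read unchanged.
  _root_.Summit.BirchSwinnertonDyer.BirchSwinnertonDyer.Theorems.AuxNormReceptacle.relativeStabilizerLaw hK ι q

/-- **(C) — generic Chebotarev–Kummer supply** (v4 split of S3♭; the ONLY place Chebotarev and Serre enter the line; `q`-free).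
For every exponent `E`, finite exclusion set `T`, and `γ ∈ 𝓞 K ∖ {0}` with `N_{K/ℚ}(γ) ∈ ℚ^{×p}` and `γ ∉ K^{×p}`: a prime `ℓ₀ ∉ T`, inert
in `K`, with `p ∤ a_{ℓ₀}(E)`, `p^E ∣ ℓ₀ + 1`, and `γ` NOT a `p`-th power modulo `ℓ₀𝓞_K` (`= 𝔽_{ℓ₀²}`). Informal proof for `E ≥ 1` (the case
`E = 0` follows from the case `E = 1`: the conclusion is monotone in `E`, `p ∣ ℓ₀ + 1 ⟹ p^0 ∣ ℓ₀ + 1`; `E ≥ 1` is what puts `μ_p ⊂ F`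
— critic VERDICT #50 T2): `F := K(E[p^E])`,
`M := F(γ^{1/p})` is Galois over `ℚ` (`conj γ = N(γ)/γ`, `N(γ)^{1/p} ∈ ℚ`; `μ_p ⊂ F`); `γ^{1/p} ∉ F` since `Gal(F/K(μ_p))^{ab}` is the
`det`-quotient `1 + pℤ/p^E` (`SL₂(ℤ/p^E)` perfect, `p ≥ 5`, image `⊇ SL₂` under (surj) by Serre), so `K(μ_p, γ^{1/p}) ⊂ F` would give
`γ ∈ μ(K)·K^{×p} = K^{×p}` (`d_K < −4`); take `g = g₀ a`, `g₀|_K = conj`, `ρ(g₀) = diag(2, −2^{-1})` (in the image: `GL₂(ℤ/p^E)`, and for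
`K = ℚ(√−p) ⊂ ℚ(E[p])`, `p ≡ 3 (4)`, `det = −1` is a non-residue so `g₀|_K = conj` is consistent), `a ∈ A := Gal(M/F) ≅ ℤ/p`; as
`χ(g₀) ≡ −1` and `conj γ^{1/p} = N(γ)^{1/p}/γ^{1/p}`, `g₀` centralises `A`, so `(g₀a)² = g₀² a²` sweeps `g₀² A` (`p` odd) and all but at most
one `a` give `g²` moving `γ^{1/p}`; Chebotarev (`Frob_{ℓ₀}(M/ℚ) ∼ g`, away from `T` and the primes dividing `2 p N_E N(γ) disc M`) yields
`ℓ₀` inert (`g|_K ≠ 1`), `a_{ℓ₀} ≡ tr = 3/2 ≢ 0`, `ℓ₀ ≡ det = −1 (mod p^E)`, and `Frob_{λ₀}(M/K) = g²` moving `γ^{1/p}` — whence `γ̄ ∉ 𝔽_{λ₀}^{×p}`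
(else `T^p − γ̄` splits into distinct linear factors, `μ_p ⊂ 𝔽_{λ₀}`, Hensel, and every decomposition group above `λ₀` fixes each `p`-th
root). A statement; asserted only by `stub_chebotarevKummerSupply`. [cite: Cox2013, Thm. 8.12 (Chebotarev), §9.A] [cite: Serre1972, §4.4 Lemme 3]
[cite: NeukirchANT1999, Ch. I §8 (8.3) (Dedekind–Kummer)] -/
def ChebotarevKummerSupply (p : ℕ) : Prop :=
  ∀ (E : ℕ) (T : Finset ℕ) (γ : 𝓞 K) (r : ℚ), γ ≠ 0 → Algebra.norm ℚ (γ : K) = r ^ p → (∀ y : K, y ^ p ≠ (γ : K)) →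
    ∃ ℓ₀ : ℕ, ℓ₀.Prime ∧ ℓ₀ ∉ T ∧ (Ideal.span {(ℓ₀ : 𝓞 K)}).IsPrime ∧ ¬ (p : ℤ) ∣ W.frobeniusTrace ℓ₀ ∧ p ^ E ∣ ℓ₀ + 1 ∧
      ¬ ∃ y : 𝓞 K, y ^ p - γ ∈ Ideal.span {(ℓ₀ : 𝓞 K)}

/-- **(O) — the Kummer witness of a split prime and the order law at prime conductor** (v4 split of S3♭; `W`-free, `ι`-free: algebraic
number theory of `K` only). For every exponent `E` there are `γ ∈ 𝓞 K ∖ {0}` with `N(γ) ∈ ℚ^{×p}`, `γ ∉ K^{×p}`, and a finite bad set `T₀`,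
such that for every prime `ℓ₀ ∉ T₀` inert in `K` with `p^E ∣ ℓ₀ + 1` modulo which `γ` is not a `p`-th power, `p^E ∣ orderOf [𝔭_v]_{ℓ₀}` for
both primes `v ∣ q`. Informal proof (`q = 𝔮𝔮̄` split, `d_K < −4`): `(β₁) = 𝔮^{h}` with `h = h_𝔮` the order of `[𝔮]` in `Cl(𝓞_K)`,
`γ := β̄₁² · (q^{h})^{p−1}` (`= β̄₁^{p+1} β₁^{p−1}` as `β₁β̄₁ = q^h` — the element of bsd-line-er5-p1-w4 g8's (O) claim; `N(γ) = (q^{2h})^p`;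
`γ ≡ x₁ := β̄₁/β₁ mod K^{×p}`, and `x₁ ∈ K^{×p}` is impossible: `β̄₁ = β₁δ^p` gives `N(δ) = 1`, Hilbert 90 `δ = ε̄/ε`, so `r' := β₁ ε^{−p}` is
conj-fixed, `r' ∈ ℚ^×`, `β₁ = r' ε^p`; write `(ε) = 𝔮^a 𝔮̄^b 𝔟` with `𝔟` prime to `q` and `(r') = (q)^k 𝔠` with `𝔠` rational and prime to `q`
[critic VERDICT #50 T1, the «𝔟 principal» line]: the `𝔮`- and `𝔮̄`-valuations of `𝔮^h = (r')(ε)^p` read `h = k + pa`, `0 = k + pb`, so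
`h = p(a − b)`, and `𝔟^p = 𝔠^{−1}` is generated by a rational number, whence so is `𝔟` itself (at a split `ℓ = 𝔩𝔩̄ ≠ q` the two exponents of
`𝔟` coincide since their `p`-multiples do; inert `ℓ`: `(ℓ)` is prime; ramified `(ℓ) = 𝔩²`: `p·j = 2k_ℓ` with `p` odd forces `j` even), so
`[𝔟] = 1` in `Cl(𝓞_K)` and `[𝔮]^{a−b} = [𝔮^a 𝔮̄^b] = [ε]·[𝔟]^{−1} = 1` with `0 < a − b = h/p < h` — contradicting the minimality of `h`), `T₀ := {q, 2, 3}`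
(+ primes dividing `N(β₁)`); then in `𝔽_{λ₀} = 𝓞_K/ℓ₀`: `x̄₁ ∉ 𝔽_{λ₀}^{×p}` so `v_p ord(x̄₁) = v_p(ℓ₀² − 1) = v_p(ℓ₀ + 1) ≥ E` (`p` odd,
`ℓ₀ ≡ −1`); `β̄₁^{ℓ₀−1} = x̄₁^{-1}` (Frobenius of `𝔽_{λ₀}` = conj) and `u ↦ u^{ℓ₀−1}` kills exactly `𝔽_{ℓ₀}^× ⊇ 𝓞_K^× = ±1`, so the image of
`β₁` in `(𝓞_K/ℓ₀)^×/(𝔽_{ℓ₀}^×·𝓞_K^×) ≅ ker(Pic 𝓞_{ℓ₀} → Cl 𝓞_K)` (the tree's theta-exactness `range_theta_eq_ker`, Cox (7.25)–(7.27)) has order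
of `p`-adic valuation `≥ E`; `[𝔮]_{ℓ₀}^{h} = θ(β₁)` and `ord c = h · ord(c^{h})` when the image of `c` in `Cl` has order `h`; finally
`[𝔮̄]_{ℓ₀} = [(q)]_{ℓ₀} [𝔮]_{ℓ₀}^{-1} = [𝔮]_{ℓ₀}^{-1}`. A statement; asserted only by `stub_splitPrimeKummerWitness`.
[cite: Cox2013, §7.C Prop. 7.22, §7.D (7.25)–(7.27), Thm. 7.24] [cite: NeukirchANT1999, Ch. I §9 (9.4), Ch. IV (Hilbert 90)] -/
def SplitPrimeKummerWitness (p q : ℕ) : Prop :=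
  ∀ E : ℕ, ∃ (γ : 𝓞 K) (r : ℚ) (T₀ : Finset ℕ), γ ≠ 0 ∧ Algebra.norm ℚ (γ : K) = r ^ p ∧ (∀ y : K, y ^ p ≠ (γ : K)) ∧
    ∀ ℓ₀ : ℕ, ℓ₀.Prime → ℓ₀ ∉ T₀ → (Ideal.span {(ℓ₀ : 𝓞 K)}).IsPrime → p ^ E ∣ ℓ₀ + 1 →
      (¬ ∃ y : 𝓞 K, y ^ p - γ ∈ Ideal.span {(ℓ₀ : 𝓞 K)}) →
      ∀ v : HeightOneSpectrum (𝓞 K), ((q : ℕ) : 𝓞 K) ∈ v.asIdeal → p ^ E ∣ orderOf (primeClass ℓ₀ v)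

/-- **S3♭ — PROVED (v6) BY NAME** by the tree theorem `Theorems.AuxPrimeSupply.auxiliaryPrimeSupply` (bsd-line-er5-p1-w2 g5,
`Theorems/ErratumRoadFiveAuxPrimeSupply.lean`, p645521: Chebotarev from the Frobenius witness of a surjective `ρ̄` at `p ≥ 5` (F2 p641931, F3a
p643880), the Kummer exclusion KEX (p645008) and the order law at prime conductor (F1 p640886), on `K` imaginary quadratic with `d_K < −4`): its
conclusion is the body of `AuxiliaryPrimeSupply W K p q N` verbatim. The v4 ∕ v5 `sorry`d leaves (C) `stub_chebotarevKummerSupply` and (O)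
`stub_splitPrimeKummerWitness` are therefore GONE from this file (their `def`s and the glue `auxiliaryPrimeSupply_of_CO` below remain: the registered
v15 stubs (C) ∕ (O), being landed by name by -w2 g5 ∕ -w4 g8, give S3♭ a second time through it). [cite: Cox2013, Thm. 8.12, §7.D, §9.A]
[cite: Serre1972, §4.4 Lemme 3] -/
theorem auxiliaryPrimeSupply_of_tree (hK : IsImaginaryQuadratic K) (hdK : NumberField.discr K < -4)
    (p : ℕ) [Fact p.Prime] (hp5 : 5 ≤ p) (hsurj : W.HasSurjectiveModNGaloisRep p)
    (q : ℕ) [Fact q.Prime] (hq2 : ((Ideal.span {(q : ℤ)}).primesOver (𝓞 K)).ncard = 2) (N : ℕ) (hN : N ≠ 0) :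
    AuxiliaryPrimeSupply W K p q N :=
  _root_.Summit.BirchSwinnertonDyer.BirchSwinnertonDyer.Theorems.AuxPrimeSupply.auxiliaryPrimeSupply W K hK hdK p hp5 hsurj q hq2 N hN

omit [W.IsElliptic] in
/-- **S3♭ from (C) and (O) (sorry-free glue):** ask (O) for the witness `γ` (and its bad set `T₀`) at exponent `E`, then (C) for `ℓ₀`
outside `T ∪ T₀ ∪ primeFactors N`. [cite: Cox2013, §7.D, Thm. 8.12] -/
theorem auxiliaryPrimeSupply_of_CO {p q N : ℕ} (hN : N ≠ 0)
    (hC : ChebotarevKummerSupply W K p) (hO : SplitPrimeKummerWitness K p q) : AuxiliaryPrimeSupply W K p q N := by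
  intro E T
  obtain ⟨γ, r, T₀, hγ0, hnorm, hnp, hord⟩ := hO E
  obtain ⟨ℓ₀, hℓ₀, hℓ₀T, hℓ₀P, ha, hE1, hnpow⟩ := hC E (T ∪ T₀ ∪ N.primeFactors) γ r hγ0 hnorm hnp
  simp only [Finset.mem_union, not_or] at hℓ₀T
  obtain ⟨⟨hT, hT₀⟩, hNf⟩ := hℓ₀T
  exact ⟨ℓ₀, hℓ₀, hT, fun h ↦ hNf (Nat.mem_primeFactors.mpr ⟨hℓ₀, h, hN⟩), hℓ₀P, ha,
    fun v hv ↦ hord ℓ₀ hℓ₀ hT₀ hℓ₀P hE1 hnpow v hv⟩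

omit [W.IsElliptic] in
/-- **S3 from S2♭ and S3♭ (sorry-free glue).** Given a guarded level `m₀` and an exponent `e`, ask S3♭ for `ℓ₀` outside
`{q} ∪ primeFactors m₀` with `p^{e + D} ∣ orderOf [𝔭_v]_{ℓ₀}`, `D := ord_p #(I_K(m₀)/P_{K,ℤ}(m₀))`; then for `w̃ ∋ q` of
`K[ℓ₀ m₀]` over `v`: `p^{e+D} ∣ orderOf [𝔭_v]_{ℓ₀} ∣ orderOf [𝔭_v]_{ℓ₀m₀} = #Stab · orderOf [𝔭_v]_{m₀}` (S2♭,
`orderOf_primeClass_dvd_of_dvd`) and `ord_p orderOf [𝔭_v]_{m₀} ≤ D` (`orderOf_dvd_natCard`, `finite_ringClassGroup`), so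
`p^e ∣ #Stab`. [cite: Cox2013, §7.C Prop. 7.22, §7.D Thm. 7.24] -/
theorem auxiliaryInertLevel_of_laws [∀ j : ℕ, NumberField (ringClassField K ι j)] (hK : IsImaginaryQuadratic K)
    {p : ℕ} [Fact p.Prime] {q : ℕ} [Fact q.Prime] {N : ℕ} (hqN : q ∣ N)
    (hS2 : RelativeStabilizerLaw K ι q) (hS3 : AuxiliaryPrimeSupply W K p q N) :
    AuxiliaryInertLevel W K ι p q N := by
  have hp : p.Prime := Fact.out
  have hq : q.Prime := Fact.out
  intro e m₀ hm₀ hg₀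
  have hm0 : m₀ ≠ 0 := hm₀.ne_zero
  haveI : Finite (RingClassGroup K m₀) := finite_ringClassGroup (K := K) (f := m₀) hK.1 hm0
  obtain ⟨ℓ₀, hℓ₀, hℓ₀T, hℓ₀N, hℓ₀P, haℓ, hord⟩ :=
    hS3 (e + (Nat.card (RingClassGroup K m₀)).factorization p) (insert q m₀.primeFactors)
  have hℓ₀q : ℓ₀ ≠ q := by
    rintro rfl
    exact hℓ₀T (Finset.mem_insert_self _ _)
  have hℓ₀m : ¬ ℓ₀ ∣ m₀ := fun h ↦
    hℓ₀T (Finset.mem_insert_of_mem (Nat.mem_primeFactors.mpr ⟨hℓ₀, h, hm0⟩))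
  have hqm : ¬ q ∣ m₀ := fun h ↦ (hg₀ q (Nat.mem_primeFactors.mpr ⟨hq, h, hm0⟩)).1 hqN
  have hqM : ¬ q ∣ ℓ₀ * m₀ := fun h ↦ ((Nat.Prime.dvd_mul hq).mp h).elim
    (fun h1 ↦ hℓ₀q ((Nat.prime_dvd_prime_iff_eq hq hℓ₀).mp h1).symm) hqm
  refine ⟨ℓ₀, hℓ₀, hℓ₀N, hℓ₀m, hℓ₀P, haℓ, fun σ hσ ↦ ?_⟩
  obtain ⟨hσn, hst⟩ := hS2 m₀ ℓ₀ hm0 hℓ₀ hℓ₀m hℓ₀P hqM σ hσ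
  refine ⟨hσn, fun w hw ↦ ?_⟩
  obtain ⟨v, hqv, hmul⟩ := hst w hw
  -- `v ∤ ℓ₀ m₀` since `q ∈ v` and `q ∤ ℓ₀ m₀`
  have hv' : ¬ Ideal.span {((ℓ₀ * m₀ : ℕ) : 𝓞 K)} ≤ v.asIdeal := by
    intro hle
    have hmem : ((ℓ₀ * m₀ : ℕ) : 𝓞 K) ∈ v.asIdeal := hle (Ideal.mem_span_singleton_self _)
    obtain ⟨a, b, hab⟩ : IsCoprime ((ℓ₀ * m₀ : ℕ) : ℤ) (q : ℤ) :=
      Nat.isCoprime_iff_coprime.mpr (Nat.Coprime.symm ((Nat.Prime.coprime_iff_not_dvd hq).mpr hqM))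
    have h1 : ((a * (ℓ₀ * m₀ : ℕ) + b * q : ℤ) : 𝓞 K) ∈ v.asIdeal := by
      push_cast
      exact v.asIdeal.add_mem (v.asIdeal.mul_mem_left _ (by exact_mod_cast hmem))
        (v.asIdeal.mul_mem_left _ hqv)
    rw [hab, Int.cast_one] at h1
    exact v.isPrime.ne_top ((Ideal.eq_top_iff_one _).mpr h1)
  have hdvd : orderOf (primeClass ℓ₀ v) ∣ orderOf (primeClass (ℓ₀ * m₀) v) :=
    orderOf_primeClass_dvd_of_dvd (dvd_mul_right ℓ₀ m₀) hv'
  have hE : p ^ (e + (Nat.card (RingClassGroup K m₀)).factorization p) ∣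
      Nat.card (MulAction.stabilizer (Subgroup.zpowers σ) w.asIdeal) * orderOf (primeClass m₀ v) := by
    rw [hmul]; exact (hord v hqv).trans hdvd
  -- sizes: both factors are nonzero, and `ord_p orderOf [𝔭_v]_{m₀} ≤ ord_p #RingClassGroup`
  have hb0 : orderOf (primeClass m₀ v) ≠ 0 := (orderOf_pos (primeClass m₀ v)).ne'
  have hbD : (orderOf (primeClass m₀ v)).factorization p ≤ (Nat.card (RingClassGroup K m₀)).factorization p :=
    (Nat.factorization_le_iff_dvd hb0 (Nat.card_pos (α := RingClassGroup K m₀)).ne').mpr (orderOf_dvd_natCard _) p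
  have hfin : IsOfFinOrder σ := isOfFinOrder_iff_pow_eq_one.mpr ⟨ℓ₀ + 1, Nat.succ_pos _, hσn⟩
  haveI : Finite (Subgroup.zpowers σ) :=
    Nat.finite_of_card_ne_zero (by rw [Nat.card_zpowers]; exact hfin.orderOf_pos.ne')
  have ha0 : Nat.card (MulAction.stabilizer (Subgroup.zpowers σ) w.asIdeal) ≠ 0 := Nat.card_pos.ne'
  have key := (hp.pow_dvd_iff_le_factorization (mul_ne_zero ha0 hb0)).mp hE
  rw [Nat.factorization_mul ha0 hb0, Finsupp.add_apply] at key
  exact (hp.pow_dvd_iff_le_factorization ha0).mpr (by omega)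

end Stubs

/-! ## §2 The composition (sorry-free): S1 ∧ S3 ∧ (B4) ∧ `p ∣ c_q` ⟹ the E′-label at the split carrier `q` -/

section Composition

variable (W : WeierstrassCurve ℚ) [W.IsElliptic] [W.IsGloballyMinimal] {K : Type} [Field K] [NumberField K]
  (ι : K →+* ℂ)

set_option maxHeartbeats 1600000 in
/-- (v5: stated over the K-LINEAR form `TateComponentFamilyLinear` of S1 — the proof uses (K3) only at `τ = σ^i ∈ ringClassGalOver ≤ ringClassGal`;
the v2–v4 statement over `TateComponentFamily` follows as `labelE0Prime_at_splitCarrier_of_stubs` right below.)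
**The E′-label at a K-split multiplicative carrier from the two stubs.** On `K` imaginary quadratic with the ring class tower
`K[·] ⊂ ℂ`, a prime `p ≥ 5`, a prime `q ∣ N` with `p ∣ c_q(E/ℚ_q)`, a family `ys` carrying Gross's norm relation (B4) (the fifth
conjunct of `ShimuraWalk.LabelsAt`), the statements S1 (at `q`) and S3 (at `p, q, N`): there is ONE `n'` prime to `p` (namely
`c_q / p^{ord_p c_q}`) with `n' • ys m ∈ E₀(K[m])_w` at every guarded level `m` and every place `w ∋ q` — VERBATIM the conclusion of
the binder `hE0T` of `ShimuraKolyvaginOfImage.exists_uniform_exponent_of_carrierLabelsE0Prime` at `q`. Proof: §0 (A3) applied to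
(B4) at the auxiliary level `ℓ₀ m` of S3 read through the component character of S1 at a place `w̃ ∣ w`.
[cite: GrossLMS1991, §3 Prop. 3.7 (1), §6 p. 245] [cite: SilvermanATAEC1994, IV Cor. 9.2 (d)] -/
theorem labelE0Prime_at_splitCarrier_of_linear [∀ j : ℕ, NumberField (ringClassField K ι j)]
    (hK : IsImaginaryQuadratic K) {p : ℕ} [Fact p.Prime] (hp5 : 5 ≤ p) {q : ℕ} [Fact q.Prime] {N : ℕ} (hqN : q ∣ N)
    (hS1 : TateComponentFamilyLinear W K ι q) (hS3 : AuxiliaryInertLevel W K ι p q N)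
    (ys : (m : ℕ) → (W.baseChange (ringClassField K ι m)).toAffine.Point)
    {y : (W.baseChange K).toAffine.Point} {ε : ℤ} (hLab : ShimuraWalk.LabelsAt W N K ι y ys ε)
    (htam : p ∣ (W.baseChange ℚ_[q]).localTamagawaNumber ℤ_[q]) :
    ∃ n' : ℕ, ¬ p ∣ n' ∧ ∀ m : ℕ, Squarefree m → (∀ r ∈ m.primeFactors, ¬ r ∣ N ∧ (Ideal.span {(r : 𝓞 K)}).IsPrime) →
      ∀ [NumberField (ringClassField K ι m)] (w : HeightOneSpectrum (𝓞 (ringClassField K ι m))),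
        ((q : ℕ) : 𝓞 (ringClassField K ι m)) ∈ w.asIdeal →
        (placeIntModel W (ringClassField K ι m) w).HasNonsingularReduction (K := ringClassField K ι m) (n' • ys m) := by
  have hp : p.Prime := Fact.out
  have hq : q.Prime := Fact.out
  -- `q` is split multiplicative and `c := ord_q Δ_min = c_q ≠ 0`, `p ∣ c`
  haveI : (W.baseChange ℚ_[q]).IsElliptic := inferInstanceAs (W.map (algebraMap ℚ ℚ_[q])).IsElliptic
  have hs : W.HasSplitMultiplicativeReductionAtPrime q :=
    hasSplitMultiplicativeReduction_of_five_le_of_dvd_localTamagawaNumber q (W.baseChange ℚ_[q]) hp5 htam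
  obtain ⟨v, hv⟩ : ∃ v : HeightOneSpectrum ℤ, (primesEquiv v : ℕ) = q :=
    ⟨primesEquiv.symm ⟨q, hq⟩, by rw [Equiv.apply_symm_apply]⟩
  have hcq : (W.baseChange ℚ_[q]).localTamagawaNumber ℤ_[q] = padicValInt q W.minimalDiscriminantInt :=
    localTamagawaNumber_eq_padicValInt_of_split W v hv hs
  have hc0 : padicValInt q W.minimalDiscriminantInt ≠ 0 := by
    rw [← hcq]; exact localTamagawaNumber_padic_ne_zero_holds q (W.baseChange ℚ_[q])
  have hpc : p ∣ padicValInt q W.minimalDiscriminantInt := by rw [← hcq]; exact htam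
  have hpe : p ^ (padicValInt q W.minimalDiscriminantInt).factorization p ∣ padicValInt q W.minimalDiscriminantInt :=
    Nat.ordProj_dvd _ _
  obtain ⟨comp, hK1, hK2, hK3⟩ := hS1
  refine ⟨padicValInt q W.minimalDiscriminantInt / p ^ (padicValInt q W.minimalDiscriminantInt).factorization p,
    Nat.not_dvd_ordCompl hp hc0, fun m₀ hm₀ hg₀ _ w₀ hw₀ ↦ ?_⟩
  -- the auxiliary level `ℓ₀ m₀`
  obtain ⟨ℓ₀, hℓ₀, hℓ₀N, hℓ₀m, hℓ₀P, haℓ, hgrp⟩ :=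
    hS3 ((padicValInt q W.minimalDiscriminantInt).factorization p) m₀ hm₀ hg₀
  have hm0 : m₀ ≠ 0 := hm₀.ne_zero
  have hM0 : ℓ₀ * m₀ ≠ 0 := mul_ne_zero hℓ₀.ne_zero hm0
  have hqm : ¬ q ∣ m₀ := fun h ↦ (hg₀ q (Nat.mem_primeFactors.mpr ⟨hq, h, hm0⟩)).1 hqN
  have hqℓ : q ≠ ℓ₀ := fun h ↦ hℓ₀N (h ▸ hqN)
  have hqM : ¬ q ∣ ℓ₀ * m₀ := fun h ↦ ((Nat.Prime.dvd_mul hq).mp h).elim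
    (fun h1 ↦ hqℓ ((Nat.prime_dvd_prime_iff_eq hq hℓ₀).mp h1)) hqm
  have hsqM : Squarefree (ℓ₀ * m₀) :=
    (Nat.squarefree_mul ((Nat.Prime.coprime_iff_not_dvd hℓ₀).mpr hℓ₀m)).mpr ⟨hℓ₀.prime.squarefree, hm₀⟩
  have hgM : ∀ r ∈ (ℓ₀ * m₀).primeFactors, ¬ r ∣ N ∧ (Ideal.span {(r : 𝓞 K)}).IsPrime := by
    intro r hr
    rw [Nat.primeFactors_mul hℓ₀.ne_zero hm0, Finset.mem_union] at hr
    rcases hr with hr | hr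
    · rw [hℓ₀.primeFactors, Finset.mem_singleton] at hr
      subst hr
      exact ⟨hℓ₀N, hℓ₀P⟩
    · exact hg₀ r hr
  have hℓmem : ℓ₀ ∈ (ℓ₀ * m₀).primeFactors := Nat.mem_primeFactors.mpr ⟨hℓ₀, dvd_mul_right _ _, hM0⟩
  -- a generator `σ` of `G_{ℓ₀}`; work at the level pair `(ℓ₀ m₀, ℓ₀ m₀ / ℓ₀)` and transport to `m₀` at the end
  obtain ⟨σ, hσ⟩ := RingClassGalOverCyclic.exists_zpowers_eq_ringClassGalOver_mul hK ι hm0 hℓ₀ hℓ₀m hℓ₀P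
  obtain ⟨hσn, hstab⟩ := hgrp σ hσ
  have hdiv : ℓ₀ * m₀ / ℓ₀ = m₀ := Nat.mul_div_cancel_left m₀ hℓ₀.pos
  have hle' : ringClassField K ι (ℓ₀ * m₀ / ℓ₀) ≤ ringClassField K ι (ℓ₀ * m₀) :=
    ringClassField_div_le hK ι (dvd_mul_right ℓ₀ m₀) hM0
  have hσ' : Subgroup.zpowers σ = ringClassGalOver ι (ℓ₀ * m₀) (ℓ₀ * m₀ / ℓ₀) := by rw [hdiv]; exact hσ
  have hm0' : ℓ₀ * m₀ / ℓ₀ ≠ 0 := by rw [hdiv]; exact hm0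
  have hqm' : ¬ q ∣ ℓ₀ * m₀ / ℓ₀ := by rw [hdiv]; exact hqm
  -- (B4) at level `ℓ₀ m₀` with `ℓ = ℓ₀`
  have h4 := hLab.2.2.2.2.1 (ℓ₀ * m₀) hsqM hgM ℓ₀ hℓmem hle' σ hσ'
  obtain ⟨f, h4f, hfcoe⟩ : ∃ f : ringClassField K ι (ℓ₀ * m₀ / ℓ₀) →ₐ[ℚ] ringClassField K ι (ℓ₀ * m₀),
      _ = W.frobeniusTrace ℓ₀ • WeierstrassCurve.Affine.Point.map (W' := W) f (ys (ℓ₀ * m₀ / ℓ₀)) ∧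
      (∀ x : ringClassField K ι (ℓ₀ * m₀ / ℓ₀), ((f x : ringClassField K ι (ℓ₀ * m₀)) : ℂ) = (x : ℂ)) :=
    ⟨_, h4, fun x ↦ RingClassField.coe_inclusion ι hle' x⟩
  -- the E′-label at level `ℓ₀ m₀ / ℓ₀`, every place `w₁ ∋ q`
  have hfin : ∀ (w₁ : HeightOneSpectrum (𝓞 (ringClassField K ι (ℓ₀ * m₀ / ℓ₀)))),
      ((q : ℕ) : 𝓞 (ringClassField K ι (ℓ₀ * m₀ / ℓ₀))) ∈ w₁.asIdeal →
      (placeIntModel W (ringClassField K ι (ℓ₀ * m₀ / ℓ₀)) w₁).HasNonsingularReduction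
        (K := ringClassField K ι (ℓ₀ * m₀ / ℓ₀))
        ((padicValInt q W.minimalDiscriminantInt / p ^ (padicValInt q W.minimalDiscriminantInt).factorization p) •
          ys (ℓ₀ * m₀ / ℓ₀)) := by
    intro w₁ hw₁
    -- a place `w̃ ∣ w₁` of `K[ℓ₀ m₀]` with compatible component characters (K2)
    obtain ⟨wt, hwtq, hwt⟩ := hK2 (ℓ₀ * m₀) (ℓ₀ * m₀ / ℓ₀) hM0 hqM (Nat.div_dvd_of_dvd (dvd_mul_right ℓ₀ m₀))
      f hfcoe w₁ hw₁
    -- read (B4) through `comp_{w̃}`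
    have key := congrArg (comp (ℓ₀ * m₀) wt) h4f
    rw [map_sum, map_zsmul, hwt (ys (ℓ₀ * m₀ / ℓ₀))] at key
    -- the conjugate places `σ^{-i} w̃`, as a function `F` on ideals
    set F : Ideal (𝓞 (ringClassField K ι (ℓ₀ * m₀))) → ZMod (padicValInt q W.minimalDiscriminantInt) :=
      fun I ↦ if h : I.IsPrime ∧ I ≠ ⊥ then comp (ℓ₀ * m₀) ⟨I, h.1, h.2⟩ (ys (ℓ₀ * m₀)) else 0 with hFdef
    have hI : ∀ i : ℕ, ((σ ^ i)⁻¹ • wt.asIdeal).IsPrime ∧ (σ ^ i)⁻¹ • wt.asIdeal ≠ ⊥ := by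
      intro i
      refine ⟨(Ideal.IsPrime.smul_iff _).mpr wt.isPrime, fun h ↦ wt.ne_bot ?_⟩
      have := congrArg (fun J : Ideal (𝓞 (ringClassField K ι (ℓ₀ * m₀))) ↦ (σ ^ i) • J) h
      simpa only [smul_inv_smul, Ideal.smul_bot] using this
    have hF : ∀ i : ℕ, F ((σ ^ i)⁻¹ • wt.asIdeal) = comp (ℓ₀ * m₀) ⟨_, (hI i).1, (hI i).2⟩ (ys (ℓ₀ * m₀)) :=
      fun i ↦ by rw [hFdef]; exact dif_pos (hI i)
    have key2 : ∑ i ∈ Finset.range (ℓ₀ + 1), F ((σ ^ i)⁻¹ • wt.asIdeal) =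
        W.frobeniusTrace ℓ₀ • comp (ℓ₀ * m₀ / ℓ₀) w₁ (ys (ℓ₀ * m₀ / ℓ₀)) := by
      rw [← key]
      refine Finset.sum_congr rfl fun i _ ↦ ?_
      rw [hF i]
      -- v5: only the K-linear part of (K3) is used: `σ ^ i ∈ G_{ℓ₀} = ringClassGalOver ι (ℓ₀m₀) m₀ ≤ 𝒢 = ringClassGal ι (ℓ₀m₀)`
      exact (hK3 (ℓ₀ * m₀) hM0 hqM (σ ^ i) wt ⟨_, (hI i).1, (hI i).2⟩
        (ringClassGalOver_le_ringClassGal ι (ℓ₀ * m₀) m₀ (hσ.le (Subgroup.npow_mem_zpowers σ i)))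
        (smul_inv_smul (σ ^ i) wt.asIdeal).symm (ys (ℓ₀ * m₀))).symm
    -- (A3): `(c / p^e) • comp_{w₁}(ys _) = 0`
    have hap : IsCoprime (W.frobeniusTrace ℓ₀) (p : ℤ) :=
      ((Prime.coprime_iff_not_dvd (Nat.prime_iff_prime_int.mp hp)).mpr haℓ).symm
    have hkill := div_pow_smul_eq_zero_of_sum_range σ hσn wt.asIdeal F hap hpe (hstab wt hwtq) key2
    -- conclude by (K1) at `w₁`
    refine (hK1 (ℓ₀ * m₀ / ℓ₀) hm0' hqm' w₁ hw₁ _).mp ?_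
    rw [map_nsmul]
    exact hkill
  rw [hdiv] at hfin
  exact hfin w₀ hw₀

/-- **The E′-label at a K-split multiplicative carrier from the two stubs** — the v2–v4 statement over S1 = `TateComponentFamily` as
REGISTERED (byte-identical signature to v4), now a one-line consequence of `labelE0Prime_at_splitCarrier_of_linear` via
`tateComponentFamilyLinear_of`. [cite: GrossLMS1991, §3 Prop. 3.7 (1), §6 p. 245] [cite: SilvermanATAEC1994, IV Cor. 9.2 (d)] -/
theorem labelE0Prime_at_splitCarrier_of_stubs [∀ j : ℕ, NumberField (ringClassField K ι j)]
    (hK : IsImaginaryQuadratic K) {p : ℕ} [Fact p.Prime] (hp5 : 5 ≤ p) {q : ℕ} [Fact q.Prime] {N : ℕ} (hqN : q ∣ N)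
    (hS1 : TateComponentFamily W K ι q) (hS3 : AuxiliaryInertLevel W K ι p q N)
    (ys : (m : ℕ) → (W.baseChange (ringClassField K ι m)).toAffine.Point)
    {y : (W.baseChange K).toAffine.Point} {ε : ℤ} (hLab : ShimuraWalk.LabelsAt W N K ι y ys ε)
    (htam : p ∣ (W.baseChange ℚ_[q]).localTamagawaNumber ℤ_[q]) :
    ∃ n' : ℕ, ¬ p ∣ n' ∧ ∀ m : ℕ, Squarefree m → (∀ r ∈ m.primeFactors, ¬ r ∣ N ∧ (Ideal.span {(r : 𝓞 K)}).IsPrime) →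
      ∀ [NumberField (ringClassField K ι m)] (w : HeightOneSpectrum (𝓞 (ringClassField K ι m))),
        ((q : ℕ) : 𝓞 (ringClassField K ι m)) ∈ w.asIdeal →
        (placeIntModel W (ringClassField K ι m) w).HasNonsingularReduction (K := ringClassField K ι m) (n' • ys m) :=
  labelE0Prime_at_splitCarrier_of_linear W ι hK hp5 hqN (tateComponentFamilyLinear_of W K ι hS1) hS3 ys hLab htam

/-- **v3 form: the E′-label at a K-split carrier from S1, S2♭, S3♭** (the glue `auxiliaryInertLevel_of_laws` inserted).
[cite: GrossLMS1991, §3 Prop. 3.7 (1), §6 p. 245] [cite: NeukirchANT1999, Ch. VI §7 Thm. (7.3)] -/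
theorem labelE0Prime_at_splitCarrier_of_laws [∀ j : ℕ, NumberField (ringClassField K ι j)]
    (hK : IsImaginaryQuadratic K) {p : ℕ} [Fact p.Prime] (hp5 : 5 ≤ p) {q : ℕ} [Fact q.Prime] {N : ℕ} (hqN : q ∣ N)
    (hS1 : TateComponentFamily W K ι q) (hS2 : RelativeStabilizerLaw K ι q) (hS3 : AuxiliaryPrimeSupply W K p q N)
    (ys : (m : ℕ) → (W.baseChange (ringClassField K ι m)).toAffine.Point)
    {y : (W.baseChange K).toAffine.Point} {ε : ℤ} (hLab : ShimuraWalk.LabelsAt W N K ι y ys ε)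
    (htam : p ∣ (W.baseChange ℚ_[q]).localTamagawaNumber ℤ_[q]) :
    ∃ n' : ℕ, ¬ p ∣ n' ∧ ∀ m : ℕ, Squarefree m → (∀ r ∈ m.primeFactors, ¬ r ∣ N ∧ (Ideal.span {(r : 𝓞 K)}).IsPrime) →
      ∀ [NumberField (ringClassField K ι m)] (w : HeightOneSpectrum (𝓞 (ringClassField K ι m))),
        ((q : ℕ) : 𝓞 (ringClassField K ι m)) ∈ w.asIdeal →
        (placeIntModel W (ringClassField K ι m) w).HasNonsingularReduction (K := ringClassField K ι m) (n' • ys m) :=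
  labelE0Prime_at_splitCarrier_of_stubs W ι hK hp5 hqN hS1 (auxiliaryInertLevel_of_laws W K ι hK hqN hS2 hS3) ys hLab htam

/-- **The binder `hE0T` from the stubs on a `p ≥ 5` Shimura frame** (`hsp`: every prime of `N` outside `S` splits in `K`): the
per-carrier E′-labels at every `q ∣ N`, `q ∉ S`, `p ∣ c_q(E/ℚ_q)` — from S1 at each such `q` (the carriers are split multiplicative
by Kodaira–Néron, `c_q ≤ 4 < p` otherwise) and S3 at `(p, q, N)`, and the (B4) conjunct of `LabelsAt`. This is VERBATIM the
hypothesis `hE0T` of `ShimuraKolyvaginOfImage.exists_uniform_exponent_of_carrierLabelsE0Prime` and of the two producers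
`ShimuraWalk.kolyvaginClass_familyData_mem_selmerLocalKer_of_labelsAt_of_tamagawa_of_E0Prime` ∕
`ShimuraWalk.localization_kolyvaginClass_familyData_mem_stringentFamily_of_labelE0Prime_singleton` (width seat -w3 g5).
[cite: GrossLMS1991, §6 proof of Prop. 6.2 (1), p. 245] [cite: SilvermanATAEC1994, IV Cor. 9.2 (d)] -/
theorem carrierLabelsE0Prime_of_stubs [∀ j : ℕ, NumberField (ringClassField K ι j)]
    (hK : IsImaginaryQuadratic K) {p : ℕ} [Fact p.Prime] (hp5 : 5 ≤ p) {N : ℕ} {S : Finset ℕ}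
    (hS1 : ∀ (q : ℕ) [Fact q.Prime], q ∣ N → q ∉ S → W.HasSplitMultiplicativeReductionAtPrime q →
      TateComponentFamily W K ι q)
    (hS3 : ∀ (q : ℕ) [Fact q.Prime], q ∣ N → q ∉ S → AuxiliaryInertLevel W K ι p q N)
    (ys : (m : ℕ) → (W.baseChange (ringClassField K ι m)).toAffine.Point)
    {y : (W.baseChange K).toAffine.Point} {ε : ℤ} (hLab : ShimuraWalk.LabelsAt W N K ι y ys ε) :
    ∀ (q : ℕ) [Fact q.Prime], q ∣ N → q ∉ S → p ∣ (W.baseChange ℚ_[q]).localTamagawaNumber ℤ_[q] →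
      ∃ n' : ℕ, ¬ p ∣ n' ∧ ∀ m : ℕ, Squarefree m → (∀ r ∈ m.primeFactors, ¬ r ∣ N ∧ (Ideal.span {(r : 𝓞 K)}).IsPrime) →
        ∀ [NumberField (ringClassField K ι m)] (w : HeightOneSpectrum (𝓞 (ringClassField K ι m))),
          ((q : ℕ) : 𝓞 (ringClassField K ι m)) ∈ w.asIdeal →
          (placeIntModel W (ringClassField K ι m) w).HasNonsingularReduction (K := ringClassField K ι m) (n' • ys m) := by
  intro q _ hqN hqS htam
  haveI : (W.baseChange ℚ_[q]).IsElliptic := inferInstanceAs (W.map (algebraMap ℚ ℚ_[q])).IsElliptic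
  have hs : W.HasSplitMultiplicativeReductionAtPrime q :=
    hasSplitMultiplicativeReduction_of_five_le_of_dvd_localTamagawaNumber q (W.baseChange ℚ_[q]) hp5 htam
  exact labelE0Prime_at_splitCarrier_of_stubs W ι hK hp5 hqN (hS1 q hqN hqS hs) (hS3 q hqN hqS) ys hLab htam

/-! ## §4 (v6) ROAD A with ONE leaf: hE0T from S1-lin alone (S2♭ and S3♭ by name) -/

/-- **ROAD A — the binder `hE0T` from the single leaf S1-lin** on a `p ≥ 5` Shimura frame with `d_K < −4`, surjective mod-`p` image, `N ≠ 0` and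
`hsp` (every prime of `N` outside `S` K-split): S2♭ := `Theorems.AuxNormReceptacle.relativeStabilizerLaw` (p642411), S3♭ := `auxiliaryPrimeSupply_of_tree`
(p645521), S3 := `auxiliaryInertLevel_of_laws`, then `labelE0Prime_at_splitCarrier_of_linear`. When bsd-line-er5-p1-w3 g6's F3 proves
`TateComponentFamilyLinear` this is hE0T outright (road A); §5 reaches the same conclusion without S1-lin (road B).
[cite: GrossLMS1991, §6 proof of Prop. 6.2 (1), p. 245] [cite: SilvermanATAEC1994, IV Cor. 9.2 (d)] -/
theorem carrierLabelsE0Prime_of_linear_leaf [∀ j : ℕ, NumberField (ringClassField K ι j)]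
    (hK : IsImaginaryQuadratic K) (hdK : NumberField.discr K < -4) {p : ℕ} [Fact p.Prime] (hp5 : 5 ≤ p)
    (hsurj : W.HasSurjectiveModNGaloisRep p) {N : ℕ} (hN : N ≠ 0) {S : Finset ℕ}
    (hsp : ∀ ℓ : ℕ, ℓ.Prime → ℓ ∣ N → ℓ ∉ S → ((Ideal.span {(ℓ : ℤ)}).primesOver (𝓞 K)).ncard = 2)
    (hS1 : ∀ (q : ℕ) [Fact q.Prime], W.HasSplitMultiplicativeReductionAtPrime q →
      ((Ideal.span {(q : ℤ)}).primesOver (𝓞 K)).ncard = 2 → TateComponentFamilyLinear W K ι q)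
    (ys : (m : ℕ) → (W.baseChange (ringClassField K ι m)).toAffine.Point)
    {y : (W.baseChange K).toAffine.Point} {ε : ℤ} (hLab : ShimuraWalk.LabelsAt W N K ι y ys ε) :
    ∀ (q : ℕ) [Fact q.Prime], q ∣ N → q ∉ S → p ∣ (W.baseChange ℚ_[q]).localTamagawaNumber ℤ_[q] →
      ∃ n' : ℕ, ¬ p ∣ n' ∧ ∀ m : ℕ, Squarefree m → (∀ r ∈ m.primeFactors, ¬ r ∣ N ∧ (Ideal.span {(r : 𝓞 K)}).IsPrime) →
        ∀ [NumberField (ringClassField K ι m)] (w : HeightOneSpectrum (𝓞 (ringClassField K ι m))),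
          ((q : ℕ) : 𝓞 (ringClassField K ι m)) ∈ w.asIdeal →
          (placeIntModel W (ringClassField K ι m) w).HasNonsingularReduction (K := ringClassField K ι m) (n' • ys m) := by
  intro q _ hqN hqS htam
  haveI : (W.baseChange ℚ_[q]).IsElliptic := inferInstanceAs (W.map (algebraMap ℚ ℚ_[q])).IsElliptic
  have hs : W.HasSplitMultiplicativeReductionAtPrime q :=
    hasSplitMultiplicativeReduction_of_five_le_of_dvd_localTamagawaNumber q (W.baseChange ℚ_[q]) hp5 htam
  have hq2 : ((Ideal.span {(q : ℤ)}).primesOver (𝓞 K)).ncard = 2 := hsp q Fact.out hqN hqS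
  exact labelE0Prime_at_splitCarrier_of_linear W ι hK hp5 hqN (hS1 q hs hq2)
    (auxiliaryInertLevel_of_laws W K ι hK hqN (stub_relativeStabilizerLaw K ι hK q)
      (auxiliaryPrimeSupply_of_tree W K hK hdK p hp5 hsurj q hq2 N hN)) ys hLab htam

end Composition

/-! ## §3 The plug into the tree (kernel-checked): one exponent for all carriers from the stubs' statements -/

example (W : WeierstrassCurve ℚ) [W.IsElliptic] [W.IsGloballyMinimal] {K : Type} [Field K] [NumberField K] (ι : K →+* ℂ)
    [∀ j : ℕ, NumberField (ringClassField K ι j)] (hK : IsImaginaryQuadratic K) {p : ℕ} [Fact p.Prime] (hp5 : 5 ≤ p)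
    {N : ℕ} [NeZero N] {S : Finset ℕ}
    (hS1 : ∀ (q : ℕ) [Fact q.Prime], q ∣ N → q ∉ S → W.HasSplitMultiplicativeReductionAtPrime q →
      TateComponentFamily W K ι q)
    (hS3 : ∀ (q : ℕ) [Fact q.Prime], q ∣ N → q ∉ S → AuxiliaryInertLevel W K ι p q N)
    (ys : (m : ℕ) → (W.baseChange (ringClassField K ι m)).toAffine.Point)
    {y : (W.baseChange K).toAffine.Point} {ε : ℤ} (hLab : ShimuraWalk.LabelsAt W N K ι y ys ε) :
    ∃ n' : ℕ, ¬ p ∣ n' ∧ ∀ (q : ℕ) [Fact q.Prime], q ∣ N → q ∉ S → p ∣ (W.baseChange ℚ_[q]).localTamagawaNumber ℤ_[q] →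
      ∀ m : ℕ, Squarefree m → (∀ r ∈ m.primeFactors, ¬ r ∣ N ∧ (Ideal.span {(r : 𝓞 K)}).IsPrime) →
        ∀ [NumberField (ringClassField K ι m)] (w : HeightOneSpectrum (𝓞 (ringClassField K ι m))),
          ((q : ℕ) : 𝓞 (ringClassField K ι m)) ∈ w.asIdeal →
          (placeIntModel W (ringClassField K ι m) w).HasNonsingularReduction (K := ringClassField K ι m) (n' • ys m) :=
  ShimuraKolyvaginOfImage.exists_uniform_exponent_of_carrierLabelsE0Prime W ι p S ys
    (fun q _ hqN hqS htam ↦ carrierLabelsE0Prime_of_stubs W ι hK hp5 hS1 hS3 ys hLab q hqN hqS htam)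

end Summit.BirchSwinnertonDyer.BirchSwinnertonDyer.Cruxes.EulerHalfNotRamNoInertSetAtFive.AuxNormReceptacle


/-! ## §5 ROAD B (v6): the binder `hE0T` with ZERO leaf stubs — (T)+(C) at an ODD prime `p ∣ c_q` over an unramified place, on the ring
class tower, composed with `ShimuraWalk.carrierLabelsE0Prime_of_galTrivial_of_kills_of_auxLevel` (bsd-stepL-tam3-p1 g18, p641143) and the
auxiliary inert level AUX = `auxiliaryInertLevel_of_laws` (S2♭ `relativeStabilizerLaw` p642411, S3♭ `AuxPrimeSupply.auxiliaryPrimeSupply` p645521) -/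

namespace Summit.BirchSwinnertonDyer.BirchSwinnertonDyer.Cruxes.EulerHalfNotRamNoInertSetAtFive.CarrierLocalE0OddPrime

open WeierstrassCurve IsDedekindDomain NumberField Field Literature.NumberTheory.EllipticCurves
  Literature.NumberTheory.EllipticCurves.RingClassField
  Literature.NumberTheory.DiophantineGeometry Literature.NumberTheory.Automorphic IsLocalRing
  Literature.NumberTheory.GaloisRepresentations Summit.BirchSwinnertonDyer.Rank1Residual.X11b.Three
  Summit.BirchSwinnertonDyer.BirchSwinnertonDyer.Theorems
  Summit.BirchSwinnertonDyer.BirchSwinnertonDyer.Theorems.CarrierLocalE0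

variable (W : WeierstrassCurve ℚ) [W.IsElliptic] [W.IsGloballyMinimal]
  {L : Type} [Field L] [NumberField L] (w : HeightOneSpectrum (𝓞 L))

/-! ### §5a Over the completion `L_w` of an unramified place `w ∣ q`: `c_w = c_q`, (C_w), (T_w) for an ODD prime `p ∣ c_q`
(port of `Theorems.CarrierLocalE0.*_of_three_dvd` ∕ `localTamagawaNumber_nsmul_mem_goodReductionSubgroup` ∕ `exists_sub_mapPoint_mem_goodReductionSubgroup`,
bsd-stepL-tam3-p1 g18 p643818, with the hypothesis `3 ∣ c_q` replaced by `p ∣ c_q`, `p` an odd prime: by the tree's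
`split_or_typeIV_of_odd_prime_dvd_localTamagawaNumber` either `q` is split multiplicative with `p ∣ ord_q Δ = c_q` (so `3 ≤ p ≤ c_q`, and
`c_q ∣ c_w ≤ max 4 (ord_w Δ) = max 4 c_q` forces `c_w = c_q`), or `p = 3`, type IV ∕ IV*, `c_q = 3` (tam3-p1's case verbatim). For `p ≥ 5` the
second branch is void: every carrier is split multiplicative.) -/

/-- **`c_w(W_L) = c_q(W)` at a place `w ∣ q` UNRAMIFIED over `ℚ` when an ODD prime `p` divides `c_q(W/ℚ_q)`** (`W/ℚ` globally minimal).
Split case (`I_n`, `p ∣ n = c_q`, `n ≥ 3`): `c_q ∣ c_w ≤ max 4 (ord_w Δ_min) = max 4 c_q`; the only other case is `p = 3`, Kodaira IV ∕ IV*, `c_q = 3`,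
where additivity transports, `c_w ≤ 4` and `3 ∣ c_w`. (FALSE for `p = 2` or without `p ∣ c_q`: `I₀*` with `c = 1, 2` may acquire `c = 4`, IV with
`c = 1` may acquire `c = 3`.) Port of `localTamagawaNumber_completion_eq_padic_of_unramified_of_three_dvd` (tam3-p1 g18) to a general odd prime.
[cite: SilvermanATAEC1994, IV Cor. 9.2 (d), IV.9.4 Table 4.1] [cite: SilvermanAEC2009, Prop. VII.5.4 (a), Thm. VII.6.1] -/
theorem localTamagawaNumber_completion_eq_padic_of_unramified_of_odd_prime_dvd (q : ℕ) [Fact q.Prime]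
    (hqw : ((q : ℕ) : 𝓞 L) ∈ w.asIdeal)
    (he : ¬ (w.under (𝓞 ℚ)).asIdeal.map (algebraMap (𝓞 ℚ) (𝓞 L)) ≤ w.asIdeal ^ 2)
    {p : ℕ} (hp : p.Prime) (hp2 : p ≠ 2) (hpc : p ∣ (W.baseChange ℚ_[q]).localTamagawaNumber ℤ_[q]) :
    ((W.baseChange L).baseChange (w.adicCompletion L)).localTamagawaNumber (w.adicCompletionIntegers L) =
      (W.baseChange ℚ_[q]).localTamagawaNumber ℤ_[q] := by
  classical
  have hqv : ((q : ℕ) : 𝓞 ℚ) ∈ (w.under (𝓞 ℚ)).asIdeal := LocalField.natCast_mem_under q w hqw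
  have hqq : ((Rat.HeightOneSpectrum.primesEquiv (w.under (𝓞 ℚ)) : Nat.Primes) : ℕ) = q :=
    LocalField.primesEquiv_eq_of_natCast_mem q _ hqv
  have hTam := WeierstrassCurve.localTamagawaNumber_padic_eq_holds W (w.under (𝓞 ℚ)) q hqq
  rw [hTam] at hpc ⊢
  -- instances at `w`
  haveI : Finite (ResidueField (w.adicCompletionIntegers L)) :=
    HeightOneSpectrum.finite_residueField_adicCompletionIntegers L w
  haveI : PerfectField (ResidueField (w.adicCompletionIntegers L)) := PerfectField.ofFinite
  haveI : PerfectField (ResidueField ((w.under (𝓞 ℚ)).adicCompletionIntegers ℚ)) := PerfectField.ofFinite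
  haveI : ((W.baseChange L).baseChange (w.adicCompletion L)).IsElliptic := by
    unfold WeierstrassCurve.baseChange; infer_instance
  haveI hWL : (W.baseChange L).IsElliptic := by unfold WeierstrassCurve.baseChange; infer_instance
  -- `c_q ∣ c_w`, `c_w ≠ 0`
  have hdvd := localTamagawaNumber_dvd_of_unramified W w he
  have hne : ((W.baseChange L).baseChange (w.adicCompletion L)).localTamagawaNumber (w.adicCompletionIntegers L) ≠ 0 :=
    WeierstrassCurve.localTamagawaNumber_ne_zero_holds (w.adicCompletionIntegers L) _
  -- Tate's algorithm is insensitive to the unramified base change `ℚ_q → L_w`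
  obtain ⟨hkod, hord⟩ := kodairaSymbolAt_baseChange_of_ramificationIdx_eq_one_holds L (w.under (𝓞 ℚ)) w W
    (algebraMap_comp_eq (L := L)) rfl he
  set cw := ((W.baseChange L).baseChange (w.adicCompletion L)).localTamagawaNumber (w.adicCompletionIntegers L) with hcw
  set cq := (W.baseChange ((w.under (𝓞 ℚ)).adicCompletion ℚ)).localTamagawaNumber ((w.under (𝓞 ℚ)).adicCompletionIntegers ℚ)
    with hcq
  obtain ⟨k, hk⟩ := hdvd
  have hk1 : 1 ≤ k := Nat.one_le_iff_ne_zero.mpr fun h0 ↦ hne (by rw [hk, h0, mul_zero])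
  rcases split_or_typeIV_of_odd_prime_dvd_localTamagawaNumber W (w.under (𝓞 ℚ)) hp hp2 hpc with
    ⟨hs, -⟩ | ⟨-, hIV, hc3⟩
  · -- split multiplicative at `q`: `c_q = ord_q Δ_min`, `c_w ≤ max 4 (ord_w Δ_min) = max 4 c_q`, and `3 ≤ p ≤ c_q`
    have hcq' : cq = W.ordMinimalDiscriminant (w.under (𝓞 ℚ)) :=
      localTamagawaNumber_eq_ordMinimalDiscriminant_of_hasSplitMultiplicativeReductionAt _ W hs
    have hle : cw ≤ max 4 cq := by
      rw [hcq', ← hord]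
      exact localTamagawaNumber_le_max_four_ordMinimalDiscriminant w (W.baseChange L)
    have hpcq : p ≤ cq := Nat.le_of_dvd (Nat.pos_of_ne_zero fun h0 ↦ hne (by rw [hk, h0, zero_mul])) hpc
    have h3p : 3 ≤ p := by have := hp.two_le; omega
    have h3cq : 3 ≤ cq := le_trans h3p hpcq
    rcases Nat.lt_or_ge k 2 with hk2 | hk2
    · have : k = 1 := by omega
      rw [hk, this, mul_one]
    · exfalso
      have : cq * 2 ≤ cq * k := Nat.mul_le_mul_left cq hk2
      rcases le_max_iff.mp hle with h4 | h4 <;> omega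
  · -- `p = 3`, Kodaira type IV ∕ IV* at `q`, `c_q = 3`: additive at `w`, so `c_w ≤ 4`, and `3 ∣ c_w` (tam3-p1 g18 verbatim)
    have hadd : W.HasAdditiveReductionAt (w.under (𝓞 ℚ)) := by
      refine (WeierstrassCurve.isAdditive_kodairaSymbolAt_iff_holds (w.under (𝓞 ℚ)) W).mp ?_
      rcases hIV with h | h <;> rw [h] <;> decide
    have haddw : (W.baseChange L).HasAdditiveReductionAt w :=
      hasAdditiveReductionAt_baseChange_of_ramificationIdx_eq_one
        (kodairaSymbolAt_baseChange_of_ramificationIdx_eq_one_holds L (w.under (𝓞 ℚ)) w W)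
        (algebraMap_comp_eq (L := L)) rfl he hadd
    have hns : ¬ (((W.baseChange L).baseChange (w.adicCompletion L)).minimal (w.adicCompletionIntegers L)).HasSplitMultiplicativeReduction
        (w.adicCompletionIntegers L) := fun hsp ↦
      WeierstrassCurve.HasMultiplicativeReductionAt.not_hasAdditiveReductionAt (W := W.baseChange L) (v := w)
        hsp.toHasMultiplicativeReduction haddw
    have hle : cw ≤ 4 := localTamagawaNumber_le_four_of_not_hasSplitMultiplicativeReduction (w.adicCompletionIntegers L) _ hns
    have hcq3 : cq = 3 := hc3
    rw [hcq3] at hk ⊢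
    omega

/-- **(C_w) `c_q • Q ∈ E₀(L_w)` for every `Q ∈ E(L_w)`** (`w ∣ q` unramified over `ℚ`, `p ∣ c_q` for an odd prime `p`): the index of `E₀(L_w)`
is `c_w = c_q`. Port of tam3-p1 g18's `localTamagawaNumber_nsmul_mem_goodReductionSubgroup`. [cite: SilvermanAEC2009, Thm. VII.6.1] -/
theorem localTamagawaNumber_nsmul_mem_goodReductionSubgroup_of_odd_prime_dvd (q : ℕ) [Fact q.Prime]
    (hqw : ((q : ℕ) : 𝓞 L) ∈ w.asIdeal)
    (he : ¬ (w.under (𝓞 ℚ)).asIdeal.map (algebraMap (𝓞 ℚ) (𝓞 L)) ≤ w.asIdeal ^ 2)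
    {p : ℕ} (hp : p.Prime) (hp2 : p ≠ 2) (hpc : p ∣ (W.baseChange ℚ_[q]).localTamagawaNumber ℤ_[q])
    (Q : ((W.baseChange L).baseChange (w.adicCompletion L)).toAffine.Point) :
    haveI := isMinimal_baseChange_adicCompletion_of_unramified W w he
    (W.baseChange ℚ_[q]).localTamagawaNumber ℤ_[q] • Q ∈
      ((W.baseChange L).baseChange (w.adicCompletion L)).goodReductionSubgroup (w.adicCompletionIntegers L) := by
  haveI := isMinimal_baseChange_adicCompletion_of_unramified W w he
  haveI : ((W.baseChange L).baseChange (w.adicCompletion L)).IsElliptic := by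
    unfold WeierstrassCurve.baseChange; infer_instance
  rw [← localTamagawaNumber_completion_eq_padic_of_unramified_of_odd_prime_dvd W w q hqw he hp hp2 hpc,
    WeierstrassCurve.localTamagawaNumber_eq_index_goodReductionSubgroup]
  exact AddSubgroup.nsmul_index_mem _ Q

/-- **(T_w) `E(L_w) = ι E(ℚ_q) + E₀(L_w)`** (`w ∣ q` unramified over `ℚ`, `p ∣ c_q` for an odd prime `p`): every `Q ∈ E(L_w)` differs from the
image of a point of `E(ℚ_q)` by a point of nonsingular reduction — the injection `E(ℚ_q)∕E₀ ↪ E(L_w)∕E₀` of finite groups of the same order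
`c_q = c_w` is onto. Port of tam3-p1 g18's `exists_sub_mapPoint_mem_goodReductionSubgroup`. [cite: SilvermanAEC2009, Thm. VII.6.1]
[cite: SilvermanATAEC1994, IV Cor. 9.2 (d)] -/
theorem exists_sub_mapPoint_mem_goodReductionSubgroup_of_odd_prime_dvd (q : ℕ) [Fact q.Prime]
    (hqw : ((q : ℕ) : 𝓞 L) ∈ w.asIdeal)
    (he : ¬ (w.under (𝓞 ℚ)).asIdeal.map (algebraMap (𝓞 ℚ) (𝓞 L)) ≤ w.asIdeal ^ 2)
    {p : ℕ} (hp : p.Prime) (hp2 : p ≠ 2) (hpc : p ∣ (W.baseChange ℚ_[q]).localTamagawaNumber ℤ_[q])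
    (Q : ((W.baseChange L).baseChange (w.adicCompletion L)).toAffine.Point) :
    haveI : w.asIdeal.LiesOver (w.under (𝓞 ℚ)).asIdeal := ⟨rfl⟩
    haveI := isMinimal_baseChange_adicCompletion_of_unramified W w he
    ∃ Q₀ : (W.baseChange ((w.under (𝓞 ℚ)).adicCompletion ℚ)).toAffine.Point,
      Q - mapPoint (adicCompletionOfLiesOver ℚ L (w.under (𝓞 ℚ)) w)
          (baseChange_baseChange_eq_map_adicCompletionOfLiesOver W w).symm Q₀ ∈
        ((W.baseChange L).baseChange (w.adicCompletion L)).goodReductionSubgroup (w.adicCompletionIntegers L) := by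
  classical
  haveI : w.asIdeal.LiesOver (w.under (𝓞 ℚ)).asIdeal := ⟨rfl⟩
  haveI hminY := isMinimal_baseChange_adicCompletion_of_unramified W w he
  haveI hminX : (W.baseChange ((w.under (𝓞 ℚ)).adicCompletion ℚ)).IsMinimal ((w.under (𝓞 ℚ)).adicCompletionIntegers ℚ) :=
    IsGloballyMinimal.isMinimal (w.under (𝓞 ℚ))
  haveI : (W.baseChange ((w.under (𝓞 ℚ)).adicCompletion ℚ)).IsElliptic := by
    unfold WeierstrassCurve.baseChange; infer_instance
  haveI : ((W.baseChange L).baseChange (w.adicCompletion L)).IsElliptic := by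
    unfold WeierstrassCurve.baseChange; infer_instance
  set f := mapPoint (adicCompletionOfLiesOver ℚ L (w.under (𝓞 ℚ)) w)
    (baseChange_baseChange_eq_map_adicCompletionOfLiesOver W w).symm with hfdef
  set H₁ := (W.baseChange ((w.under (𝓞 ℚ)).adicCompletion ℚ)).goodReductionSubgroup ((w.under (𝓞 ℚ)).adicCompletionIntegers ℚ) with hH₁
  set H₂ := ((W.baseChange L).baseChange (w.adicCompletion L)).goodReductionSubgroup (w.adicCompletionIntegers L) with hH₂
  have hle : H₁ ≤ H₂.comap f := fun P hP ↦ by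
    rw [AddSubgroup.mem_comap, WeierstrassCurve.mem_goodReductionSubgroup_iff_holds]
    rw [WeierstrassCurve.mem_goodReductionSubgroup_iff_holds] at hP
    exact (isNonsingularReductionPoint_mapPoint_iff_of_unramified W w he P).mpr hP
  set φ := QuotientAddGroup.map H₁ H₂ f hle with hφ
  have hinj : Function.Injective φ := fun a b hab ↦ by
    obtain ⟨P, rfl⟩ := QuotientAddGroup.mk_surjective a
    obtain ⟨P', rfl⟩ := QuotientAddGroup.mk_surjective b
    rw [hφ, QuotientAddGroup.map_mk, QuotientAddGroup.map_mk, QuotientAddGroup.eq] at hab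
    rw [QuotientAddGroup.eq]
    rw [← map_neg, ← map_add, WeierstrassCurve.mem_goodReductionSubgroup_iff_holds,
      isNonsingularReductionPoint_mapPoint_iff_of_unramified W w he] at hab
    exact (WeierstrassCurve.mem_goodReductionSubgroup_iff_holds _ _ _).mpr hab
  -- both quotients are finite of the same cardinality `c_q = c_w`
  have hqv : ((q : ℕ) : 𝓞 ℚ) ∈ (w.under (𝓞 ℚ)).asIdeal := LocalField.natCast_mem_under q w hqw
  have hqq : ((Rat.HeightOneSpectrum.primesEquiv (w.under (𝓞 ℚ)) : Nat.Primes) : ℕ) = q :=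
    LocalField.primesEquiv_eq_of_natCast_mem q _ hqv
  have hcard : Nat.card (_ ⧸ H₁) = Nat.card (_ ⧸ H₂) := by
    rw [← AddSubgroup.index_eq_card, ← AddSubgroup.index_eq_card,
      ← WeierstrassCurve.localTamagawaNumber_eq_index_goodReductionSubgroup,
      ← WeierstrassCurve.localTamagawaNumber_eq_index_goodReductionSubgroup,
      localTamagawaNumber_completion_eq_padic_of_unramified_of_odd_prime_dvd W w q hqw he hp hp2 hpc,
      WeierstrassCurve.localTamagawaNumber_padic_eq_holds W (w.under (𝓞 ℚ)) q hqq]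
  have hne : Nat.card (_ ⧸ H₂) ≠ 0 := by
    rw [← AddSubgroup.index_eq_card, ← WeierstrassCurve.localTamagawaNumber_eq_index_goodReductionSubgroup]
    exact WeierstrassCurve.localTamagawaNumber_ne_zero_holds (w.adicCompletionIntegers L) _
  haveI : Finite (_ ⧸ H₂) := Nat.finite_of_card_ne_zero hne
  haveI : Finite (_ ⧸ H₁) := Nat.finite_of_card_ne_zero (hcard ▸ hne)
  obtain ⟨e⟩ := Finite.card_eq.mp hcard
  have hsurj : Function.Surjective φ := (Finite.injective_iff_surjective_of_equiv e).mp hinj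
  obtain ⟨a, ha⟩ := hsurj (QuotientAddGroup.mk Q)
  obtain ⟨Q₀, rfl⟩ := QuotientAddGroup.mk_surjective a
  rw [hφ, QuotientAddGroup.map_mk, QuotientAddGroup.eq] at ha
  refine ⟨Q₀, ?_⟩
  rwa [sub_eq_add_neg, add_comm]

/-! ### §5b The GLOBAL forms on `L`-points at `w` for the model `W` (port of `Theorems.CarrierLocalE0.hasNonsingularReduction_localTamagawaNumber_nsmul`
∕ `hasNonsingularReduction_pointGalHom_sub`, bsd-stepL-tam3-p1 g18 p644399, `3 ∣ c_q` ↦ odd `p ∣ c_q`) -/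

/-- **(C) `c_q • P ∈ E₀(L)_w`** for every `P ∈ E(L)` — `w ∣ q` unramified over `ℚ`, `p ∣ c_q(W/ℚ_q)` for an odd prime `p`.
[cite: SilvermanAEC2009, Thm. VII.6.1] [cite: SilvermanATAEC1994, IV Cor. 9.2 (d)] -/
theorem hasNonsingularReduction_localTamagawaNumber_nsmul_of_odd_prime_dvd (q : ℕ) [Fact q.Prime]
    (hqw : ((q : ℕ) : 𝓞 L) ∈ w.asIdeal)
    (he : ¬ (w.under (𝓞 ℚ)).asIdeal.map (algebraMap (𝓞 ℚ) (𝓞 L)) ≤ w.asIdeal ^ 2)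
    {p : ℕ} (hp : p.Prime) (hp2 : p ≠ 2) (hpc : p ∣ (W.baseChange ℚ_[q]).localTamagawaNumber ℤ_[q])
    (P : (W.baseChange L).toAffine.Point) :
    (placeIntModel W L w).HasNonsingularReduction (K := L) ((W.baseChange ℚ_[q]).localTamagawaNumber ℤ_[q] • P) := by
  rw [hasNonsingularReduction_placeIntModel_iff_mapPoint_mem W w he, map_nsmul]
  exact localTamagawaNumber_nsmul_mem_goodReductionSubgroup_of_odd_prime_dvd W w q hqw he hp hp2 hpc _

/-- **(T) every `τ ∈ Aut_ℚ(L)` fixing `w` acts trivially on `E(L) ∕ E₀(L)_w`** — `τ P − P ∈ E₀(L)_w` — for `w ∣ q` unramified over `ℚ` and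
`p ∣ c_q(W/ℚ_q)` for an odd prime `p`: in `E(L_w) = ι E(ℚ_q) + E₀(L_w)` write the image of `P` as `ι Q₀ + R`; the continuous extension `τ_w`
fixes `ι Q₀` and preserves `E₀(L_w)`, so `τ P − P ↦ τ_w R − R ∈ E₀(L_w)` (tam3-p1 g18's proof verbatim, (T_w) at an odd prime).
[cite: SilvermanAEC2009, Thm. VII.6.1, VII §2 Prop. 2.1] [cite: CasselsFrohlichANT1967, Ch. VII §1.1] -/
theorem hasNonsingularReduction_pointGalHom_sub_of_odd_prime_dvd (q : ℕ) [Fact q.Prime]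
    (hqw : ((q : ℕ) : 𝓞 L) ∈ w.asIdeal)
    (he : ¬ (w.under (𝓞 ℚ)).asIdeal.map (algebraMap (𝓞 ℚ) (𝓞 L)) ≤ w.asIdeal ^ 2)
    {p : ℕ} (hp : p.Prime) (hp2 : p ≠ 2) (hpc : p ∣ (W.baseChange ℚ_[q]).localTamagawaNumber ℤ_[q])
    (τ : L ≃ₐ[ℚ] L) (hτ : τ • w = w) (P : (W.baseChange L).toAffine.Point) :
    (placeIntModel W L w).HasNonsingularReduction (K := L) (pointGalHom W L τ P - P) := by
  classical
  haveI : w.asIdeal.LiesOver (w.under (𝓞 ℚ)).asIdeal := ⟨rfl⟩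
  haveI hminY := isMinimal_baseChange_adicCompletion_of_unramified W w he
  rw [hasNonsingularReduction_placeIntModel_iff_mapPoint_mem W w he, map_sub]
  -- the transport `T = (τ_w)_*` on `E(L_w)`
  set Y := (W.baseChange L).baseChange (w.adicCompletion L) with hYdef
  set τw := galAdicCompletionEquiv (L := L) τ hτ with hτw
  have hfix : ∀ r : ℚ, (τw : w.adicCompletion L →+* w.adicCompletion L)
      (algebraMap L (w.adicCompletion L) (algebraMap ℚ L r)) = algebraMap L (w.adicCompletion L) (algebraMap ℚ L r) :=
    fun r ↦ galAdicCompletionMap_algebraMap ℚ τ hτ r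
  have hT : Y.map (τw : w.adicCompletion L →+* w.adicCompletion L) = Y := by
    rw [hYdef, WeierstrassCurve.baseChange, WeierstrassCurve.baseChange, WeierstrassCurve.map_map, WeierstrassCurve.map_map]
    have hcomp : ((τw : w.adicCompletion L →+* w.adicCompletion L).comp
        ((algebraMap L (w.adicCompletion L)).comp (algebraMap ℚ L))) =
        (algebraMap L (w.adicCompletion L)).comp (algebraMap ℚ L) :=
      RingHom.ext fun r ↦ hfix r
    exact congrArg (fun f : ℚ →+* w.adicCompletion L ↦ W.map f) hcomp
  -- `T` preserves `E₀(L_w)`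
  obtain ⟨ψ, hψ⟩ : ∃ ψ : w.adicCompletionIntegers L ≃+* w.adicCompletionIntegers L,
      ∀ r, (τw : w.adicCompletion L →+* w.adicCompletion L) (algebraMap _ (w.adicCompletion L) r) = algebraMap _ _ (ψ r) := by
    refine ⟨RingEquiv.ofBijective
      (((τw : w.adicCompletion L →+* w.adicCompletion L).comp (w.adicCompletionIntegers L).subtype).codRestrict
        (w.adicCompletionIntegers L) (fun x ↦ ?_)) ⟨fun a b hab ↦ ?_, fun b ↦ ?_⟩, fun r ↦ rfl⟩
    · exact (galAdicCompletionMap_mem_adicCompletionIntegers_iff (L := L) τ hτ (x : w.adicCompletion L)).mpr x.2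
    · exact Subtype.ext (τw.injective (congrArg Subtype.val hab))
    · refine ⟨⟨τw.symm b, ?_⟩, Subtype.ext (τw.apply_symm_apply b)⟩
      rw [hτw, galAdicCompletionEquiv_symm_apply]
      exact (galAdicCompletionMap_mem_adicCompletionIntegers_iff (L := L) τ⁻¹ (inv_smul_eq_of_smul_eq hτ) (b : w.adicCompletion L)).mpr b.2
  have hE0 : ∀ R : Y.toAffine.Point, R ∈ Y.goodReductionSubgroup (w.adicCompletionIntegers L) →
      mapPoint (τw : w.adicCompletion L →+* w.adicCompletion L) hT R ∈ Y.goodReductionSubgroup (w.adicCompletionIntegers L) := by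
    intro R hR
    rw [WeierstrassCurve.mem_goodReductionSubgroup_iff_holds] at hR ⊢
    exact (Summit.BirchSwinnertonDyer.Rank1Residual.JET.isNonsingularReductionPoint_mapPoint_iff ψ τw hψ Y hT R).mpr hR
  -- `T ∘ ι = ι` on points and `T ∘ j = j ∘ τ`
  have hTι : ∀ Q₀ : (W.baseChange ((w.under (𝓞 ℚ)).adicCompletion ℚ)).toAffine.Point,
      mapPoint (τw : w.adicCompletion L →+* w.adicCompletion L) hT
        (mapPoint (adicCompletionOfLiesOver ℚ L (w.under (𝓞 ℚ)) w) (baseChange_baseChange_eq_map_adicCompletionOfLiesOver W w).symm Q₀) =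
      mapPoint (adicCompletionOfLiesOver ℚ L (w.under (𝓞 ℚ)) w) (baseChange_baseChange_eq_map_adicCompletionOfLiesOver W w).symm Q₀ := by
    rintro (_ | ⟨x, y, hxy⟩)
    · rfl
    · simp only [mapPoint_some]
      exact Affine.Point.some.injEq _ _ _ _ _ _ |>.mpr
        ⟨galAdicCompletionMap_adicCompletionOfLiesOver w τ hτ _, galAdicCompletionMap_adicCompletionOfLiesOver w τ hτ _⟩
  have hTj : mapPoint (τw : w.adicCompletion L →+* w.adicCompletion L) hT (mapPoint (algebraMap L (w.adicCompletion L)) rfl P) =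
      mapPoint (algebraMap L (w.adicCompletion L)) rfl (pointGalHom W L τ P) := by
    rcases P with _ | ⟨x, y, hxy⟩
    · rfl
    · rw [pointGalHom_apply, Affine.Point.map_some]
      simp only [mapPoint_some]
      exact Affine.Point.some.injEq _ _ _ _ _ _ |>.mpr
        ⟨galAdicCompletionMap_coe_algEquiv ℚ τ hτ _, galAdicCompletionMap_coe_algEquiv ℚ τ hτ _⟩
  -- (T_w) decomposition of the image of `P`
  obtain ⟨Q₀, hQ₀⟩ := exists_sub_mapPoint_mem_goodReductionSubgroup_of_odd_prime_dvd W w q hqw he hp hp2 hpc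
    (mapPoint (algebraMap L (w.adicCompletion L)) rfl P)
  have h1 := hE0 _ hQ₀
  rw [map_sub, hTι, hTj] at h1
  have h2 := (Y.goodReductionSubgroup (w.adicCompletionIntegers L)).sub_mem h1 hQ₀
  rwa [sub_sub_sub_cancel_right] at h2

/-- (T) for an ARBITRARY `DecidableEq L` instance on the coordinates (`DecidableEq L` is a subsingleton; the ring class tower may carry a
non-classical instance). [cite: SilvermanAEC2009, Thm. VII.6.1] -/
theorem hasNonsingularReduction_pointGalHom_sub_of_odd_prime_dvd' (W : WeierstrassCurve ℚ) [W.IsElliptic] [W.IsGloballyMinimal]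
    {L : Type} [Field L] [NumberField L] [DecidableEq L] (w : HeightOneSpectrum (𝓞 L)) (q : ℕ) [Fact q.Prime]
    (hqw : ((q : ℕ) : 𝓞 L) ∈ w.asIdeal)
    (he : ¬ (w.under (𝓞 ℚ)).asIdeal.map (algebraMap (𝓞 ℚ) (𝓞 L)) ≤ w.asIdeal ^ 2)
    {p : ℕ} (hp : p.Prime) (hp2 : p ≠ 2) (hpc : p ∣ (W.baseChange ℚ_[q]).localTamagawaNumber ℤ_[q])
    (τ : L ≃ₐ[ℚ] L) (hτ : τ • w = w) (P : (W.baseChange L).toAffine.Point) :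
    (placeIntModel W L w).HasNonsingularReduction (K := L) (pointGalHom W L τ P - P) := by
  obtain rfl : ‹DecidableEq L› = fun a b ↦ Classical.propDecidable (a = b) := Subsingleton.elim _ _
  exact hasNonsingularReduction_pointGalHom_sub_of_odd_prime_dvd W w q hqw he hp hp2 hpc τ hτ P

/-- (C) for an ARBITRARY `DecidableEq L` instance on the coordinates. [cite: SilvermanAEC2009, Thm. VII.6.1] -/
theorem hasNonsingularReduction_localTamagawaNumber_nsmul_of_odd_prime_dvd' (W : WeierstrassCurve ℚ) [W.IsElliptic] [W.IsGloballyMinimal]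
    {L : Type} [Field L] [NumberField L] [DecidableEq L] (w : HeightOneSpectrum (𝓞 L)) (q : ℕ) [Fact q.Prime]
    (hqw : ((q : ℕ) : 𝓞 L) ∈ w.asIdeal)
    (he : ¬ (w.under (𝓞 ℚ)).asIdeal.map (algebraMap (𝓞 ℚ) (𝓞 L)) ≤ w.asIdeal ^ 2)
    {p : ℕ} (hp : p.Prime) (hp2 : p ≠ 2) (hpc : p ∣ (W.baseChange ℚ_[q]).localTamagawaNumber ℤ_[q])
    (P : (W.baseChange L).toAffine.Point) :
    (placeIntModel W L w).HasNonsingularReduction (K := L) ((W.baseChange ℚ_[q]).localTamagawaNumber ℤ_[q] • P) := by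
  obtain rfl : ‹DecidableEq L› = fun a b ↦ Classical.propDecidable (a = b) := Subsingleton.elim _ _
  exact hasNonsingularReduction_localTamagawaNumber_nsmul_of_odd_prime_dvd W w q hqw he hp hp2 hpc P

/-! ### §5c On the ring class tower `K[n]` of an imaginary quadratic `K` at a K-SPLIT carrier `q ∤ n` (unramified: `not_map_le_sq_ringClassField`,
bsd-stepL-tam3-p1 g18 p645044, `h3`-free — restated here VERBATIM with its proof because the farm snapshot had not yet built that module at the
time of writing; cite the tree theorem `Theorems.CarrierLocalE0.not_map_le_sq_ringClassField` once built) -/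

/-- **`K[n]` is unramified over `ℚ` at a place `w ∋ q` with `q ∤ n`, `q` split in `K`**: `¬ (q)𝓞_{K[n]} ≤ w²` — `e(w | v) = 1` for `v = w ∩ 𝓞_K ∤ n`
(ring class fields are unramified outside the conductor, `ramificationIdx_ringClassField_eq_one`) and `e(v | q) = 1` (`q` splits in the quadratic
`K`). VERBATIM bsd-stepL-tam3-p1 g18's `Theorems.CarrierLocalE0.not_map_le_sq_ringClassField` (p645044), statement and proof.
[cite: Cox2013, §9.A (ring class fields unramified outside the conductor), §7.B] [cite: NeukirchANT1999, Ch. I §9 (9.4)] -/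
theorem not_map_le_sq_ringClassField_of_split (K : Type) [Field K] [NumberField K] (ι : K →+* ℂ)
    [∀ j : ℕ, NumberField (ringClassField K ι j)] (hK : IsImaginaryQuadratic K) (q : ℕ) [Fact q.Prime]
    (hq2 : ((Ideal.span {(q : ℤ)}).primesOver (𝓞 K)).ncard = 2) (n : ℕ) (hn : n ≠ 0) (hqn : ¬ q ∣ n)
    (w : HeightOneSpectrum (𝓞 (ringClassField K ι n))) (hqw : ((q : ℕ) : 𝓞 (ringClassField K ι n)) ∈ w.asIdeal) :
    ¬ (w.under (𝓞 ℚ)).asIdeal.map (algebraMap (𝓞 ℚ) (𝓞 (ringClassField K ι n))) ≤ w.asIdeal ^ 2 := by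
  classical
  have hq : q.Prime := Fact.out
  -- the place `v = w ∩ 𝓞_K` of `K` below `w`
  let v : HeightOneSpectrum (𝓞 K) := w.under (𝓞 K)
  haveI : w.asIdeal.LiesOver v.asIdeal := ⟨rfl⟩
  have hqv : ((q : ℕ) : 𝓞 K) ∈ v.asIdeal := by
    change ((q : ℕ) : 𝓞 K) ∈ w.asIdeal.comap (algebraMap (𝓞 K) (𝓞 (ringClassField K ι n)))
    rw [Ideal.mem_comap, map_natCast]
    exact hqw
  -- `v ∤ n`
  have hvn : ¬ Ideal.span {((n : ℕ) : 𝓞 K)} ≤ v.asIdeal := by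
    intro hle
    have hnv : ((n : ℕ) : 𝓞 K) ∈ v.asIdeal := hle (Ideal.mem_span_singleton_self _)
    have hcop : IsCoprime ((q : ℤ) : 𝓞 K) ((n : ℤ) : 𝓞 K) :=
      (Nat.isCoprime_iff_coprime.mpr ((Nat.Prime.coprime_iff_not_dvd hq).mpr hqn)).map (Int.castRingHom (𝓞 K))
    rw [Int.cast_natCast, Int.cast_natCast] at hcop
    obtain ⟨a, b, hab⟩ := hcop
    exact v.isPrime.ne_top ((Ideal.eq_top_iff_one _).mpr (hab ▸ v.asIdeal.add_mem (v.asIdeal.mul_mem_left a hqv)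
      (v.asIdeal.mul_mem_left b hnv)))
  -- `e(w | v) = 1` (ring class fields are unramified outside the conductor)
  haveI : w.asIdeal.IsPrime := w.isPrime
  have hewv : w.asIdeal.ramificationIdx (𝓞 K) = 1 := ramificationIdx_ringClassField_eq_one hK ι hn hvn w.asIdeal
  -- `e(v | q) = 1` (`q` splits in `K`)
  haveI : Algebra.IsQuadraticExtension ℚ K := ⟨hK.1⟩
  have hcard : Nat.card (K ≃ₐ[ℚ] K) = 2 := by rw [IsGalois.card_aut_eq_finrank, hK.1]
  obtain ⟨τ, hτ, huniq⟩ := (Nat.card_eq_two_iff' (1 : K ≃ₐ[ℚ] K)).mp hcard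
  have hτ2 : τ * τ = 1 := by
    rw [mul_eq_one_iff_eq_inv]
    exact (huniq τ⁻¹ (inv_ne_one.mpr hτ)).symm
  obtain ⟨v₀, hv₀, -, hqv₀⟩ := ShimuraWalk.exists_split_place_of_ncard_eq_two K hK τ hτ q hq2 (dvd_refl q)
  obtain ⟨σ, hσ⟩ := HeightOneSpectrum.exists_algEquiv_smul_eq (F := ℚ) (w := v₀) (w' := v)
    (LocalField.heightOneSpectrum_rat_eq_of_natCast_mem q _ _
      (LocalField.natCast_mem_under q v₀ hqv₀) (LocalField.natCast_mem_under q v hqv))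
  have hτv : τ • v ≠ v := by
    by_cases hσ1 : σ = 1
    · subst hσ1
      rw [one_smul] at hσ
      rw [← hσ]
      exact hv₀
    · have hστ : σ = τ := huniq σ hσ1
      subst hστ
      rw [← hσ, smul_smul, hτ2, one_smul]
      exact fun h ↦ hv₀ h.symm
  have hqτv : ((q : ℕ) : 𝓞 K) ∈ (τ • v).asIdeal := by
    have := (HeightOneSpectrum.smul_mem_smul_asIdeal_iff τ v ((q : ℕ) : 𝓞 K)).mpr hqv
    have hτq : τ • ((q : ℕ) : 𝓞 K) = (q : 𝓞 K) := by
      rw [← MulSemiringAction.toRingHom_apply, map_natCast]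
    rwa [hτq] at this
  obtain ⟨⟨hev, -⟩, -⟩ := LocalField.ramificationIdx_eq_one_and_inertiaDeg_eq_one_of_ne q v (τ • v) hτv.symm hqv hqτv
  -- in `ramificationIdx'` currency, tower formula
  haveI : v.asIdeal.LiesOver (v.under (𝓞 ℚ)).asIdeal := ⟨rfl⟩
  haveI : w.asIdeal.LiesOver (w.under (𝓞 ℚ)).asIdeal := ⟨rfl⟩
  have hunder : w.under (𝓞 ℚ) = v.under (𝓞 ℚ) := HeightOneSpectrum.ext (Ideal.under_under w.asIdeal).symm
  haveI : v.asIdeal.LiesOver (w.under (𝓞 ℚ)).asIdeal := by rw [hunder]; exact ⟨rfl⟩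
  have h1 : (w.under (𝓞 ℚ)).asIdeal.ramificationIdx' v.asIdeal = 1 := by
    rw [Ideal.ramificationIdx'_eq_ramificationIdx _ _ (w.under (𝓞 ℚ)).ne_bot, ← hev]
  have h2 : v.asIdeal.ramificationIdx' w.asIdeal = 1 := by
    rw [Ideal.ramificationIdx'_eq_ramificationIdx _ _ v.ne_bot, hewv]
  have h3 : (w.under (𝓞 ℚ)).asIdeal.ramificationIdx' w.asIdeal = 1 := by
    rw [Ideal.ramificationIdx'_algebra_tower' (w.under (𝓞 ℚ)).asIdeal v.asIdeal w.asIdeal, h1, h2]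
  have hle : (w.under (𝓞 ℚ)).asIdeal.map (algebraMap (𝓞 ℚ) (𝓞 (ringClassField K ι n))) ≤ w.asIdeal :=
    Ideal.map_le_iff_le_comap.mpr le_rfl
  exact (not_iff_not.mpr (Ideal.ramificationIdx'_ne_one_iff hle)).mp (not_not.mpr h3)

/-- **(T) and (C) at a K-split carrier on the whole ring class tower, for an odd prime `p ∣ c_q`** — VERBATIM the per-carrier bodies of the binders
`hT`, `hC` of `ShimuraWalk.carrierLabelsE0Prime_of_galTrivial_of_kills_of_auxLevel` (p641143). The `p ≥ 5` twin of tam3-p1 g18's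
`stub_carrierLocalE0AtThree`. [cite: SilvermanATAEC1994, IV Cor. 9.2 (d), IV.9.4 Table 4.1] [cite: SilvermanAEC2009, Thm. VII.6.1] [cite: Cox2013, §9.A] -/
theorem carrierLocalE0_ringClassField_of_odd_prime_dvd (W : WeierstrassCurve ℚ) [W.IsElliptic] [W.IsGloballyMinimal]
    (K : Type) [Field K] [NumberField K] (ι : K →+* ℂ) [∀ j : ℕ, NumberField (ringClassField K ι j)]
    (hK : IsImaginaryQuadratic K) (q : ℕ) [Fact q.Prime] {p : ℕ} (hp : p.Prime) (hp2 : p ≠ 2)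
    (hpc : p ∣ (W.baseChange ℚ_[q]).localTamagawaNumber ℤ_[q])
    (hq2 : ((Ideal.span {(q : ℤ)}).primesOver (𝓞 K)).ncard = 2) :
    (∀ n : ℕ, n ≠ 0 → ¬ q ∣ n → ∀ (w : HeightOneSpectrum (𝓞 (ringClassField K ι n))),
      ((q : ℕ) : 𝓞 (ringClassField K ι n)) ∈ w.asIdeal →
      ∀ τ : ringClassField K ι n ≃ₐ[ℚ] ringClassField K ι n, τ • w.asIdeal = w.asIdeal →
      ∀ P : (W.baseChange (ringClassField K ι n)).toAffine.Point,
        (placeIntModel W (ringClassField K ι n) w).HasNonsingularReduction (K := ringClassField K ι n)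
          (pointGalHom W (ringClassField K ι n) τ P - P)) ∧
    (∀ n : ℕ, n ≠ 0 → ¬ q ∣ n → ∀ (w : HeightOneSpectrum (𝓞 (ringClassField K ι n))),
      ((q : ℕ) : 𝓞 (ringClassField K ι n)) ∈ w.asIdeal →
      ∀ P : (W.baseChange (ringClassField K ι n)).toAffine.Point,
        (placeIntModel W (ringClassField K ι n) w).HasNonsingularReduction (K := ringClassField K ι n)
          ((W.baseChange ℚ_[q]).localTamagawaNumber ℤ_[q] • P)) := by
  refine ⟨fun n hn hqn w hqw τ hτ P ↦ ?_, fun n hn hqn w hqw P ↦ ?_⟩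
  · have he := not_map_le_sq_ringClassField_of_split K ι hK q hq2 n hn hqn w hqw
    have hτ' : τ • w = w := HeightOneSpectrum.ext hτ
    exact hasNonsingularReduction_pointGalHom_sub_of_odd_prime_dvd' W w q hqw he hp hp2 hpc τ hτ' P
  · exact hasNonsingularReduction_localTamagawaNumber_nsmul_of_odd_prime_dvd' W w q hqw
      (not_map_le_sq_ringClassField_of_split K ι hK q hq2 n hn hqn w hqw) hp hp2 hpc P

end Summit.BirchSwinnertonDyer.BirchSwinnertonDyer.Cruxes.EulerHalfNotRamNoInertSetAtFive.CarrierLocalE0OddPrime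

/-! ### §5d ROAD B assembled: the binder `hE0T` on a `p ≥ 5` Shimura frame with NO leaf stub -/

namespace Summit.BirchSwinnertonDyer.BirchSwinnertonDyer.Cruxes.EulerHalfNotRamNoInertSetAtFive.AuxNormReceptacle

open WeierstrassCurve IsDedekindDomain NumberField Field Literature.NumberTheory.EllipticCurves
  Literature.NumberTheory.GaloisRepresentations Summit.BirchSwinnertonDyer.Rank1Residual.X11b
  Summit.BirchSwinnertonDyer.BirchSwinnertonDyer.Theorems Rat.HeightOneSpectrum
  Literature.NumberTheory.NumberFields Literature.NumberTheory.NumberFields.RingClassField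
  Literature.NumberTheory.QuadraticFields.RingClass

/-- **ROAD B — the binder `hE0T` of 19715's carrier-label receptacle on a `p ≥ 5` frame, from TREE THEOREMS ONLY (zero leaf stubs).**
`K` imaginary quadratic with `d_K < −4`, `p ≥ 5` with surjective mod-`p` image, `N ≠ 0`, every prime `q ∣ N` outside `S` split in `K` (`hsp`),
a family `ys` with `ShimuraWalk.LabelsAt W N K ι y ys ε` ((B4) = Gross's norm relation): at every carrier `q ∣ N`, `q ∉ S`, `p ∣ c_q` there is
ONE `n'` prime to `p` with `n' • ys m ∈ E₀(K[m])_w` at every guarded level `m` and every `w ∋ q` — the SAME conclusion as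
`carrierLabelsE0Prime_of_stubs` ∕ `Theorems.AuxNormReceptacle.carrierLabelsE0Prime_of_leaves` (road A: S1-lin ∧ S2♭ ∧ S3♭), with NO S1 ∕ S1-lin
∕ (C) ∕ (O) hypothesis. Assembly: `ShimuraWalk.carrierLabelsE0Prime_of_galTrivial_of_kills_of_auxLevel` (bsd-stepL-tam3-p1 g18, p641143: (B4)
read through (T) «`Aut_ℚ(K[ℓ₀m])_w̃` acts trivially on `E ∕ E₀,w̃`» and (C) «`c_q` kills `E ∕ E₀`» instead of component characters, then the
orbit count (A1′) and the `ZMod`-free arithmetic `a·y ∈ p^e·E + E₀`, `c_q·E ⊆ E₀` ⟹ `(c_q/p^e)·y ∈ E₀`) fed with: hT, hC :=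
`CarrierLocalE0OddPrime.carrierLocalE0_ringClassField_of_odd_prime_dvd` (§5c: Kodaira–Néron over the unramified completions `K[n]_w ∕ ℚ_q`,
`c_w = c_q` because `p ∣ c_q` forces split `I_{c_q}` with `c_q ≥ p ≥ 3`); hAux := this file's glue `auxiliaryInertLevel_of_laws` (= the tree's
`Theorems.AuxNormReceptacle.auxiliaryInertLevel_of_laws`, p644422, verbatim) from S2♭ `Theorems.AuxNormReceptacle.relativeStabilizerLaw` (bsd-line-er5-p1-w4 g8, p642411) and S3♭
`Theorems.AuxPrimeSupply.auxiliaryPrimeSupply` (bsd-line-er5-p1-w2 g5, p645521: Chebotarev from the Frobenius witness of a surjective `ρ̄`,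
Kummer exclusion, the order law at prime conductor). HONEST FRAMING: this discharges the binder `hE0T` of the LEAD's graft
(`Lines/birth.lean` v15 §-graft ∕ `Theorems/ErratumRoadFiveEulerHalfNotRamNoInertSetAtFiveOfItems.lean`) on frames with `d_K < −4`; it does NOT
close 19715 (the other binders — hB7@S and the print-fact items 19713 ∕ 19714 ∕ 19716 ∕ 20529-aside ∕ 19064 — are untouched), proves no summit
statement, and BSD is proved for no curve. [cite: GrossLMS1991, §3 Prop. 3.7 (1), §6 proof of Prop. 6.2 (1) (p. 245 «E′»)]
[cite: SilvermanATAEC1994, IV Cor. 9.2 (d), IV.9.4 Table 4.1] [cite: SilvermanAEC2009, Thm. VII.6.1] [cite: Cox2013, Thm. 7.24, Thm. 8.12, §9.A]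
[cite: Serre1972, §4.4 Lemme 3] -/
theorem carrierLabelsE0Prime_of_galTrivialRoad (W : WeierstrassCurve ℚ) [W.IsElliptic] [W.IsGloballyMinimal]
    {K : Type} [Field K] [NumberField K] (ι : K →+* ℂ) [∀ j : ℕ, NumberField (ringClassField K ι j)]
    (hK : IsImaginaryQuadratic K) (hdK : NumberField.discr K < -4) {p : ℕ} [Fact p.Prime] (hp5 : 5 ≤ p)
    (hsurj : W.HasSurjectiveModNGaloisRep p) {N : ℕ} (hN : N ≠ 0) {S : Finset ℕ}
    (hsp : ∀ ℓ : ℕ, ℓ.Prime → ℓ ∣ N → ℓ ∉ S → ((Ideal.span {(ℓ : ℤ)}).primesOver (𝓞 K)).ncard = 2)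
    (ys : (m : ℕ) → (W.baseChange (ringClassField K ι m)).toAffine.Point)
    {y : (W.baseChange K).toAffine.Point} {ε : ℤ} (hLab : ShimuraWalk.LabelsAt W N K ι y ys ε) :
    ∀ (q : ℕ) [Fact q.Prime], q ∣ N → q ∉ S → p ∣ (W.baseChange ℚ_[q]).localTamagawaNumber ℤ_[q] →
      ∃ n' : ℕ, ¬ p ∣ n' ∧ ∀ m : ℕ, Squarefree m → (∀ r ∈ m.primeFactors, ¬ r ∣ N ∧ (Ideal.span {(r : 𝓞 K)}).IsPrime) →
        ∀ [NumberField (ringClassField K ι m)] (w : HeightOneSpectrum (𝓞 (ringClassField K ι m))),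
          ((q : ℕ) : 𝓞 (ringClassField K ι m)) ∈ w.asIdeal →
          (placeIntModel W (ringClassField K ι m) w).HasNonsingularReduction (K := ringClassField K ι m) (n' • ys m) := by
  have hp : p.Prime := Fact.out
  have hp2 : p ≠ 2 := by omega
  refine ShimuraWalk.carrierLabelsE0Prime_of_galTrivial_of_kills_of_auxLevel W ι hK
    (fun q _ hqN hqS hpc ↦
      (_root_.Summit.BirchSwinnertonDyer.BirchSwinnertonDyer.Cruxes.EulerHalfNotRamNoInertSetAtFive.CarrierLocalE0OddPrime.carrierLocalE0_ringClassField_of_odd_prime_dvd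
        W K ι hK q hp hp2 hpc (hsp q Fact.out hqN hqS)).1)
    (fun q _ hqN hqS hpc ↦
      (_root_.Summit.BirchSwinnertonDyer.BirchSwinnertonDyer.Cruxes.EulerHalfNotRamNoInertSetAtFive.CarrierLocalE0OddPrime.carrierLocalE0_ringClassField_of_odd_prime_dvd
        W K ι hK q hp hp2 hpc (hsp q Fact.out hqN hqS)).2)
    (fun q _ hqN hqS _ ↦
      -- AUX: this file's glue `auxiliaryInertLevel_of_laws` (= the tree's `Theorems.AuxNormReceptacle.auxiliaryInertLevel_of_laws`, p644422,
      -- verbatim) from S2♭ (tree, p642411) and S3♭ (tree, p645521); its value `AuxiliaryInertLevel W K ι p q N` is p641143's `hAux` body.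
      auxiliaryInertLevel_of_laws W K ι hK hqN (stub_relativeStabilizerLaw K ι hK q)
        (auxiliaryPrimeSupply_of_tree W K hK hdK p hp5 hsurj q (hsp q Fact.out hqN hqS) N hN))
    ys hLab

/-- **§3-twin for road B: one exponent for all carriers, from tree theorems only** (the plug of `carrierLabelsE0Prime_of_galTrivialRoad` into
`ShimuraKolyvaginOfImage.exists_uniform_exponent_of_carrierLabelsE0Prime`). [cite: GrossLMS1991, §6 proof of Prop. 6.2 (1), p. 245] -/
theorem exists_uniform_exponent_of_galTrivialRoad (W : WeierstrassCurve ℚ) [W.IsElliptic] [W.IsGloballyMinimal]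
    {K : Type} [Field K] [NumberField K] (ι : K →+* ℂ) [∀ j : ℕ, NumberField (ringClassField K ι j)]
    (hK : IsImaginaryQuadratic K) (hdK : NumberField.discr K < -4) {p : ℕ} [Fact p.Prime] (hp5 : 5 ≤ p)
    (hsurj : W.HasSurjectiveModNGaloisRep p) {N : ℕ} [NeZero N] {S : Finset ℕ}
    (hsp : ∀ ℓ : ℕ, ℓ.Prime → ℓ ∣ N → ℓ ∉ S → ((Ideal.span {(ℓ : ℤ)}).primesOver (𝓞 K)).ncard = 2)
    (ys : (m : ℕ) → (W.baseChange (ringClassField K ι m)).toAffine.Point)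
    {y : (W.baseChange K).toAffine.Point} {ε : ℤ} (hLab : ShimuraWalk.LabelsAt W N K ι y ys ε) :
    ∃ n' : ℕ, ¬ p ∣ n' ∧ ∀ (q : ℕ) [Fact q.Prime], q ∣ N → q ∉ S → p ∣ (W.baseChange ℚ_[q]).localTamagawaNumber ℤ_[q] →
      ∀ m : ℕ, Squarefree m → (∀ r ∈ m.primeFactors, ¬ r ∣ N ∧ (Ideal.span {(r : 𝓞 K)}).IsPrime) →
        ∀ [NumberField (ringClassField K ι m)] (w : HeightOneSpectrum (𝓞 (ringClassField K ι m))),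
          ((q : ℕ) : 𝓞 (ringClassField K ι m)) ∈ w.asIdeal →
          (placeIntModel W (ringClassField K ι m) w).HasNonsingularReduction (K := ringClassField K ι m) (n' • ys m) :=
  ShimuraKolyvaginOfImage.exists_uniform_exponent_of_carrierLabelsE0Prime W ι p S ys
    (fun q _ hqN hqS htam ↦ carrierLabelsE0Prime_of_galTrivialRoad W ι hK hdK hp5 hsurj (NeZero.ne N) hsp ys hLab q hqN hqS htam)

end Summit.BirchSwinnertonDyer.BirchSwinnertonDyer.Cruxes.EulerHalfNotRamNoInertSetAtFive.AuxNormReceptacle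

end
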